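import Mathlib.Analysis.Polynomial.CauchyBound
import Literature.NumberTheory.Automorphic.JacquetShalikaEulerProducts
import Literature.NumberTheory.Automorphic.AdicCompletionCompact
import HarnessLib

/-!
# The trivial bound on Hecke–Satake parameters, and `multipliable_L` from Jacquet–Shalika's
Lemma (5.2) alone

Trunk `AutomorphicAxiomatic` (G19), topic `NumberTheory/Automorphic`; namespace `Literature.Automorphic`.
Companion to `AutomorphicLFunction` / `AutomorphicLFunctionProofs` /
`JacquetShalikaEulerProducts`.

## Purpose

`JacquetShalikaEulerProducts` reduced the named fact `StandardLFunctionData.multipliable_L`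
(absolute convergence of the standard Euler product of a cuspidal `Π` on `re s > 1`,
Jacquet–Shalika (1981), Thm. (5.3) with Remark (5.4)) to the two *numbered* results of the
source: the local bound `|μ_{j,v}| ≤ q_v^{1/2}` (Cor. (2.5) / (5.1.3), named fact
`norm_satakeParameter_le_sqrt`, whose printed proof is the classification of unitary generic
unramified representations of `GL_r(F)`, §2 of the paper) and the analytic continuation of
`L_S(s, π × π̄)` to `re s > 1` (Lemma (5.2), named fact
`JacquetShalika1981_continuation_partialPairL_conj`, the Rankin–Selberg method of §4).

This file removes the first input. In the printed proof of Thm. (5.3) the bound (5.1.3) enters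
twice: (i) to give a right half-plane on which the Euler product (5.1.4) for `L_S(s, π × π̄)`
converges absolutely and equals the exponential of the non-negative Dirichlet series (5.3.3)
(p. 554: the product "converges absolutely to an analytic function in some right half-plane";
p. 556: "using (5.1.3), we get for Re(s) large ..."), which is all that Landau's lemma needs; and
(ii) after Landau's lemma, to expand the local factors `(1 - z)⁻¹`, `|z| < 1`, on `re s > 1`
(p. 555). For (i) *any* bound `|μ_{j,v}| ≤ q_v^B` with `B` independent of `v` serves (the
half-plane becomes `re s > 2B + 1`); for (ii), (5.1.3) is by then a *consequence* of the
convergence of (5.3.3) for `re s > 1` (the Cesàro argument `norm_le_of_mem_of_normSq_powerSum_le`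
of `AutomorphicLFunctionProofs`, here in the pointwise form `norm_le_sqrt_of_summable_normSq_trace`).
A bound as in (i) — the **trivial bound** — holds for the tree's honest Hecke–Satake parameters
for elementary reasons, and is *proved* here (`IsSatakeFamilyOf.norm_le`):

* the Hecke operator `[Kf t Kf] = ∑_{y Kf ⊆ Kf t Kf} R(y)` (`heckeOperator` of `HeckeAlgebra`) is
  a sum of `#(Kf t Kf / Kf)` isometries of `L²` (`norm_rightRegular_apply`), so a Hecke
  eigenvalue has absolute value `≤ #(Kf t Kf / Kf)` (and is `0` if the double coset is infinite,
  the operator then being the junk value `0`): `norm_le_ncard_orbit_of_heckeOperator_apply_eq_smul`;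
* for `Kf = K(𝔫)` (`principalCongruenceLevel`), `v ∤ 𝔫` and `t = t_{v,i} = diag(ϖ_v^{(i)}, 1)`
  (`heckeDiagAt`), the kernel of reduction modulo `𝓂_v` (`levelReduction : K(𝔫) → GL_n(𝓀_v)`)
  stabilises the coset `t K(𝔫)`: if `k ≡ 1 (mod 𝓂_v)` then `t⁻¹ k t ∈ K(𝔫)`
  (`conj_heckeDiagAt_mem_principalCongruenceLevel`, a valuation count on the entries
  `ϖ^{-e_a} k_{ab} ϖ^{e_b}`); hence `#(K(𝔫) t K(𝔫) / K(𝔫)) = [K(𝔫) : Stab] ≤ [K(𝔫) : ker] ≤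
  #M_n(𝓀_v) ≤ q_v^{n²}` (`ncard_orbit_heckeDiagAt_le`; `#𝓀_v ≤ q_v` from the surjection
  `𝓞 K / v → 𝓀_v` of `AdicCompletionCompact`);
* so `|q_v^{j(n-j)/2} e_j(α v)| ≤ q_v^{n²}` for the eigenvalues recorded by `HasSatakeParameterAt`,
  `|e_j(α v)| ≤ q_v^{n²}`, and Cauchy's bound for the roots of `∏_{a ∈ α v} (X - a) =
  ∑_j (-1)^j e_j X^{n-j}` (Mathlib `Polynomial.IsRoot.norm_lt_cauchyBound`) gives
  `|a| ≤ q_v^{n²} + 1 ≤ q_v^{n² + 1}` for every `a ∈ α v`.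

With this bound in place of (5.1.3), the Landau argument of `JacquetShalikaEulerProducts` runs
unchanged (`summable_normSq_trace_of_continuation_of_rpow`: abscissa `≤ 2B + 1` instead of `≤ 2`),
the series (5.3.3) converges for `σ > 1`, the bound `|μ_{j,v}| ≤ q_v^{1/2}` is then *recovered*
for the family at hand (`norm_le_sqrt_of_summable_normSq_trace`), and the estimate
`summable_norm_inv_eulerFactor_sub_one` of `JacquetShalikaEulerProducts` finishes the proof of
Thm. (5.3).

## Main results

* `IsSatakeFamilyOf.norm_le` (**proved, no named inputs**): for a Satake family `α` of a cuspidal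
  `Π` of `GL_n(𝔸_K)` away from `S`, every `a ∈ α v`, `v ∉ S`, has `‖a‖ ≤ q_v^{n²} + 1`;
  `IsSatakeFamilyOf.norm_le_rpow`: `‖a‖ ≤ q_v^{n² + 1}`.
* `StandardLFunctionData.multipliable_L_of_lemma52'`: the named fact `multipliable_L` of
  `AutomorphicLFunction` follows from the **single** named input
  `JacquetShalika1981_continuation_partialPairL_conj` (Jacquet–Shalika (1981), Lemma (5.2)).
* `absolutelyConvergent_partialStandardL_of_lemma52'`, `multipliable_partialStandardL_of_lemma52'`,
  `StandardLFunctionData.L_eq_partialStandardL_mul_of_lemma52'`: the same for the partial Euler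
  products away from an arbitrary `S`, using in addition only the finiteness of the set of
  ramified places (`eventually_cofinite_isUnramifiedAt` of `GLnCuspidalSpectrum`, Flath).
* `norm_le_sqrt_finset_of_lemma52`: Lemma (5.2) alone gives (5.1.3) away from the finite sets
  `S ⊇ S₀` of the lemma.
* `absolutelyConvergent_partialStandardL_of_lt_re`, `multipliable_partialStandardL_of_lt_re`,
  `StandardLFunctionData.multipliable_of_lt_re` (**proved, no named inputs**): the partial and
  full standard Euler products of a cuspidal `Π` converge absolutely on `re s > n² + 2` (the
  analogue of loc. cit. (5.1.4), "converges absolutely in some right half-plane", made explicit by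
  the trivial bound).

Resulting dependency graph of the Jacquet–Shalika facts of the tree:
`multipliable_L ⇐ {Lemma (5.2)}`;
`absolutelyConvergent_partialStandardL, multipliable_partialStandardL, L_eq_partialStandardL_mul
⇐ {Lemma (5.2), Flath}`; unchanged: `summable_normSq_trace_satakePow ⇐ {(5.1.3), Lemma (5.2),
Flath}` (for `v` unramified but inside the exceptional set `S₀` of the lemma, the convergence of
`∑_k |tr A_v^k|² / (k q_v^{kσ})` for `σ > 1` *is* the bound (5.1.3) at `v`, which Lemma (5.2)
does not see).

## Design notes

* The reduction map is built in two steps: `integerMatrixHom : GL_m(𝒪_F) →* M_m(𝒪_F)` (entries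
  of an element of `valuedCongruenceSubgroup m 1` as valuation integers) followed by
  `RingHom.mapMatrix (IsLocalRing.residue 𝒪_F)`, valued in the *monoid* `M_m(𝓀_F)`; the group
  homomorphism `levelReduction` is its `MonoidHom.toHomUnits`. Only the inequality
  `#𝓀_v ≤ q_v` is needed (and proved); equality is true but not used.
* `heckeOperator_eq_zero_of_infinite` exists in `JacquetLanglandsParts` (generic in the
  representation); a private copy is used here to keep the import graph of this file inside the
  `AutomorphicLFunction` cluster.
* Nothing here restates or weakens a named fact: all `_of_lemma52'` theorems conclude the
  pre-existing `Prop`s of `AutomorphicLFunction` / `AutomorphicLFunctionProofs` literally.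

## References

* H. Jacquet, J. A. Shalika, *On Euler products and the classification of automorphic
  representations I*, Amer. J. Math. 103 (1981), 499–558: Thm. (5.3), Lemma (5.2), Remark (5.4),
  and p. 556 of the proof of Thm. (5.3).
* G. Shimura, *Introduction to the arithmetic theory of automorphic functions* (1971), Ch. 3
  (double cosets `Kf t Kf = ⋃ y Kf` and their degree).
* D. Bump, *Automorphic forms and representations* (1997), §3.3–3.4.
-/

noncomputable section

open scoped MatrixGroups ComplexConjugate Valued
open NumberField IsDedekindDomain MeasureTheory Complex

namespace Literature.NumberTheory.Automorphic


/-! ### The residue field of `𝒪_v` has at most `q_v` elements -/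

section ResidueField

variable (K : Type*) [Field K] [NumberField K] (v : HeightOneSpectrum (𝓞 K))

/-- **`#𝓀_v ≤ #(𝓞 K ⧸ v)`.** The residue field of the valuation ring `𝒪_v` of `K_v` is a
quotient of `𝓞 K ⧸ v`: the residue map `𝓞 K → 𝒪_v → 𝓀_v` is onto
(`exists_ringOfIntegers_valued_sub_lt_one` of `AdicCompletionCompact`: density of `𝓞 K` in `𝒪_v`)
and factors through `𝓞 K ⧸ v` (the same construction as `finite_residueField_adicCompletion`,
recording the cardinality inequality instead of finiteness). Weil, *Basic Number Theory*,
Ch. III §1. [folklore] -/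
theorem natCard_residueField_adicCompletion_le :
    Nat.card 𝓀[v.adicCompletion K] ≤ Nat.card (𝓞 K ⧸ v.asIdeal) := by
  classical
  -- the map `𝓞 K → 𝒪_v → 𝓀_v` (as in `finite_residueField_adicCompletion`)
  have hval : ∀ c : K, Valued.v (algebraMap K (v.adicCompletion K) c) = v.valuation K c :=
    fun c => HeightOneSpectrum.valuedAdicCompletion_eq_valuation' v c
  let ι : 𝓞 K → 𝒪[v.adicCompletion K] := fun a =>
    ⟨algebraMap K (v.adicCompletion K) (algebraMap (𝓞 K) K a), by
      change Valued.v (algebraMap K (v.adicCompletion K) (algebraMap (𝓞 K) K a)) ≤ 1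
      rw [hval]
      exact HeightOneSpectrum.valuation_le_one v a⟩
  let f : 𝓞 K → 𝓀[v.adicCompletion K] := fun a =>
    IsLocalRing.residue (𝒪[v.adicCompletion K]) (ι a)
  have hmax : ∀ z : 𝒪[v.adicCompletion K],
      z ∈ IsLocalRing.maximalIdeal (𝒪[v.adicCompletion K]) ↔
        Valued.v (z : v.adicCompletion K) < 1 := fun z => by
    rw [IsLocalRing.mem_maximalIdeal, mem_nonunits_iff]
    exact Valuation.Integer.not_isUnit_iff_valuation_lt_one
  have hf : Function.Surjective f := by
    intro q
    obtain ⟨x, rfl⟩ := IsLocalRing.residue_surjective q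
    obtain ⟨a, ha⟩ := exists_ringOfIntegers_valued_sub_lt_one K v x
    refine ⟨a, ?_⟩
    change Ideal.Quotient.mk _ (ι a) = Ideal.Quotient.mk _ x
    rw [Ideal.Quotient.eq, hmax]
    exact ha
  haveI : Finite (𝓞 K ⧸ v.asIdeal) := v.asIdeal.finiteQuotientOfFreeOfNeBot v.ne_bot
  have hfact : ∀ a b : 𝓞 K, Ideal.Quotient.mk v.asIdeal a = Ideal.Quotient.mk v.asIdeal b →
      f a = f b := by
    intro a b hab
    rw [Ideal.Quotient.eq] at hab
    change Ideal.Quotient.mk _ (ι a) = Ideal.Quotient.mk _ (ι b)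
    rw [Ideal.Quotient.eq, hmax]
    have hlt : v.valuation K (algebraMap (𝓞 K) K (a - b)) < 1 :=
      (HeightOneSpectrum.valuation_lt_one_iff_mem v (a - b)).2 hab
    have : ((ι a - ι b : 𝒪[v.adicCompletion K]) : v.adicCompletion K) =
        algebraMap K (v.adicCompletion K) (algebraMap (𝓞 K) K (a - b)) := by
      change algebraMap K (v.adicCompletion K) (algebraMap (𝓞 K) K a) -
          algebraMap K (v.adicCompletion K) (algebraMap (𝓞 K) K b) = _
      rw [← map_sub, ← map_sub]
    rw [this, hval]
    exact hlt
  let g : 𝓞 K ⧸ v.asIdeal → 𝓀[v.adicCompletion K] :=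
    Quotient.lift f fun a b (hab : (QuotientAddGroup.leftRel _) a b) =>
      hfact a b (Quotient.sound hab)
  refine Nat.card_le_card_of_surjective g fun q => ?_
  obtain ⟨a, rfl⟩ := hf q
  exact ⟨Ideal.Quotient.mk v.asIdeal a, rfl⟩

/-- **`#𝓀_v ≤ q_v`** (`q_v = v.residueCard = #(𝓞 K ⧸ v)`). [folklore] -/
theorem natCard_residueField_adicCompletion_le_residueCard :
    Nat.card 𝓀[v.adicCompletion K] ≤ v.residueCard := by
  rw [HeightOneSpectrum.residueCard_eq_card_quotient]
  exact natCard_residueField_adicCompletion_le K v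

end ResidueField

/-! ### Reduction of `GL_m(𝒪_F)` modulo the maximal ideal -/

section Reduction

variable {F Γ₀ : Type*} [Field F] [LinearOrderedCommGroupWithZero Γ₀] [Valued F Γ₀]
  (m : Type*) [Fintype m] [DecidableEq m]

/-- The entries of `g ∈ GL_m(𝒪_F)` (the valued congruence subgroup of radius `1`: `g` and `g⁻¹`
integral) as elements of the valuation ring `𝒪_F = 𝒪[F]` (Bushnell–Henniart §7.1). [folklore] -/
def integerMatrix (g : valuedCongruenceSubgroup (F := F) m (1 : Γ₀)) : Matrix m m 𝒪[F] :=
  fun i j => ⟨((g : GL m F) : Matrix m m F) i j, g.2.1 i j⟩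

/-- The `(i, j)` entry of `integerMatrix m g` is the `(i, j)` entry of `g` (definitional). [folklore] -/
@[simp]
theorem coe_integerMatrix_apply (g : valuedCongruenceSubgroup (F := F) m (1 : Γ₀)) (i j : m) :
    ((integerMatrix m g i j : 𝒪[F]) : F) = ((g : GL m F) : Matrix m m F) i j := rfl

/-- `integerMatrix m g`, mapped back to `F`, is the matrix of `g` (definitional). [folklore] -/
theorem integerMatrix_map_subtype (g : valuedCongruenceSubgroup (F := F) m (1 : Γ₀)) :
    (integerMatrix m g).map ((𝒪[F]).subtype) = ((g : GL m F) : Matrix m m F) := rfl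

/-- `g ↦ integerMatrix m g` is a monoid homomorphism `GL_m(𝒪_F) →* M_m(𝒪_F)` (matrix
multiplication commutes with the injective ring map `𝒪_F → F`). [folklore] -/
def integerMatrixHom : valuedCongruenceSubgroup (F := F) m (1 : Γ₀) →* Matrix m m 𝒪[F] where
  toFun := integerMatrix m
  map_one' := by
    apply Matrix.map_injective (𝒪[F]).subtype_injective
    change (integerMatrix m 1).map ((𝒪[F]).subtype) = (1 : Matrix m m 𝒪[F]).map ((𝒪[F]).subtype)
    rw [integerMatrix_map_subtype, Matrix.map_one _ (map_zero _) (map_one _)]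
    rfl
  map_mul' g h := by
    apply Matrix.map_injective (𝒪[F]).subtype_injective
    change (integerMatrix m (g * h)).map ((𝒪[F]).subtype) =
      (integerMatrix m g * integerMatrix m h).map ((𝒪[F]).subtype)
    rw [Matrix.map_mul, integerMatrix_map_subtype, integerMatrix_map_subtype,
      integerMatrix_map_subtype]
    rfl

/-- **Reduction modulo the maximal ideal**, `GL_m(𝒪_F) →* M_m(𝓀_F)`, `g ↦ (g mod 𝓂_F)`: the
composite of `integerMatrixHom` with `RingHom.mapMatrix (IsLocalRing.residue 𝒪_F)`, valued in
the multiplicative monoid of matrices over the residue field (Bushnell–Henniart §7.1; Serre,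
*Local Fields*, Ch. IV §2). [folklore] -/
def reductionHom : valuedCongruenceSubgroup (F := F) m (1 : Γ₀) →* Matrix m m 𝓀[F] :=
  (IsLocalRing.residue 𝒪[F]).mapMatrix.toMonoidHom.comp (integerMatrixHom m)

/-- Entries of the reduction: `(reductionHom m g) i j = residue (g i j)` (definitional). [folklore] -/
theorem reductionHom_apply (g : valuedCongruenceSubgroup (F := F) m (1 : Γ₀)) (i j : m) :
    reductionHom m g i j = IsLocalRing.residue 𝒪[F] (integerMatrix m g i j) := rfl

/-- If `g ≡ 1 (mod 𝓂_F)` then the off-diagonal entries of `g` have valuation `< 1`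
(`IsLocalRing.residue_eq_zero_iff`, `Valuation.Integer.not_isUnit_iff_valuation_lt_one`).
[folklore] -/
theorem valuation_apply_lt_one_of_reductionHom_eq_one
    {g : valuedCongruenceSubgroup (F := F) m (1 : Γ₀)} (hg : reductionHom m g = 1) {i j : m}
    (hij : i ≠ j) : Valued.v (((g : GL m F) : Matrix m m F) i j) < 1 := by
  have h := congrFun (congrFun hg i) j
  rw [reductionHom_apply, Matrix.one_apply_ne hij, IsLocalRing.residue_eq_zero_iff,
    IsLocalRing.mem_maximalIdeal, mem_nonunits_iff,
    Valuation.Integer.not_isUnit_iff_valuation_lt_one] at h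
  exact h

/-- If `g ≡ 1 (mod 𝓂_F)` then the diagonal entries of `g - 1` have valuation `< 1`. [folklore] -/
theorem valuation_apply_sub_one_lt_one_of_reductionHom_eq_one
    {g : valuedCongruenceSubgroup (F := F) m (1 : Γ₀)} (hg : reductionHom m g = 1) (i : m) :
    Valued.v (((g : GL m F) : Matrix m m F) i i - 1) < 1 := by
  have h := congrFun (congrFun hg i) i
  rw [reductionHom_apply, Matrix.one_apply_eq, ← sub_eq_zero, ← map_one (IsLocalRing.residue 𝒪[F]),
    ← map_sub, IsLocalRing.residue_eq_zero_iff,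
    IsLocalRing.mem_maximalIdeal, mem_nonunits_iff,
    Valuation.Integer.not_isUnit_iff_valuation_lt_one] at h
  exact h

end Reduction



/-! ### A local valuation estimate for conjugation by `diag(ϖ^{(i)})` -/

section LocalEstimate

variable {F Γ₀ : Type*} [Field F] [LinearOrderedCommGroupWithZero Γ₀] [Valued F Γ₀]
  {m : Type*}

/-- **The local count behind `t⁻¹ k t ∈ GL_n(𝒪_v)`.** Let `ϖ ≠ 0` with `|ϖ| ≤ 1`, and let `M` be
a matrix with integral entries whose off-diagonal entries have valuation `≤ |ϖ|`. Then every
entry `ϖ^{-[p a]} M_{ab} ϖ^{[p b]}` of `D⁻¹ M D`, `D = diag(ϖ^{[p a]})`, is integral: the only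
entries acquiring a factor `ϖ⁻¹` are off-diagonal (`p a ∧ ¬ p b` forces `a ≠ b`)
(the valuation count in the standard computation of the double cosets
`GL_n(𝒪) diag(ϖ^{(i)}) GL_n(𝒪)`, Shimura, Ch. 3). [folklore] -/
theorem valuation_diag_conj_apply_le_one (p : m → Prop) [DecidablePred p] {ϖ : F} (hϖ0 : ϖ ≠ 0)
    (hϖ1 : Valued.v ϖ ≤ 1) {M : Matrix m m F} (h1 : ∀ a b, Valued.v (M a b) ≤ 1)
    (h2 : ∀ a b, a ≠ b → Valued.v (M a b) ≤ Valued.v ϖ) (a b : m) :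
    Valued.v ((if p a then ϖ else 1)⁻¹ * M a b * (if p b then ϖ else 1)) ≤ 1 := by
  have hv0 : Valued.v ϖ ≠ 0 := (Valuation.ne_zero_iff _).mpr hϖ0
  rw [map_mul, map_mul, map_inv₀]
  by_cases pa : p a <;> by_cases pb : p b <;>
    simp only [pa, pb, if_true, if_false, map_one, inv_one, one_mul, mul_one]
  · calc (Valued.v ϖ)⁻¹ * Valued.v (M a b) * Valued.v ϖ
          = (Valued.v ϖ)⁻¹ * Valued.v ϖ * Valued.v (M a b) := mul_right_comm _ _ _
      _ = Valued.v (M a b) := by rw [inv_mul_cancel₀ hv0, one_mul]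
      _ ≤ 1 := h1 a b
  · have hab : a ≠ b := fun h => pb (h ▸ pa)
    calc (Valued.v ϖ)⁻¹ * Valued.v (M a b) ≤ (Valued.v ϖ)⁻¹ * Valued.v ϖ :=
          mul_le_mul_right (h2 a b hab) _
      _ = 1 := inv_mul_cancel₀ hv0
  · calc Valued.v (M a b) * Valued.v ϖ ≤ 1 * 1 := mul_le_mul' (h1 a b) hϖ1
      _ = 1 := one_mul 1
  · exact h1 a b

/-- A matrix with integral entries is congruent to `1` "up to radius `1`": the entries of `M - 1`
are integral (ultrametric inequality). [folklore] -/
theorem valuation_sub_one_apply_le_one_of_forall {M : Matrix m m F} [DecidableEq m]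
    (h1 : ∀ a b, Valued.v (M a b) ≤ 1) (a b : m) :
    Valued.v ((M - 1) a b) ≤ 1 := by
  rw [Matrix.sub_apply]
  refine (Valued.v.map_sub _ _).trans (max_le (h1 a b) ?_)
  rw [Matrix.one_apply]
  split_ifs <;> simp

end LocalEstimate

/-! ### The Hecke element `t_{v,i}` and conjugation of small level elements -/

section Conjugation

variable (n : ℕ) (K : Type) [Field K] [NumberField K] (v : HeightOneSpectrum (𝓞 K))

/-- The diagonal entries of the Hecke element `t_{v,i}`: the idele `(1_∞; ϖ at v, 1 elsewhere)`
in the first `i` slots and `1` in the others, so that `heckeDiagAt n K v ϖ i = glDiagonal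
(heckeDiagEntry n K v ϖ i)` (`heckeDiagAt_eq_glDiagonal`, definitional; Bump §3.3). [folklore] -/
def heckeDiagEntry (ϖ : (v.adicCompletion K)ˣ) (i : ℕ) (k : Fin n) : (AdeleRing (𝓞 K) K)ˣ :=
  if k.val < i then
    Units.map (MonoidHom.inr (InfiniteAdeleRing K) (FiniteAdeleRing (𝓞 K) K) :
      FiniteAdeleRing (𝓞 K) K →* AdeleRing (𝓞 K) K) (uniformizerIdele K v ϖ)
  else 1

/-- `t_{v,i} = diag(heckeDiagEntry)` (definitional unfolding of `heckeDiagAt`). [folklore] -/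
theorem heckeDiagAt_eq_glDiagonal (ϖ : (v.adicCompletion K)ˣ) (i : ℕ) :
    heckeDiagAt n K v ϖ i = glDiagonal n (AdeleRing (𝓞 K) K) (heckeDiagEntry n K v ϖ i) := rfl

/-- The archimedean component of each diagonal entry of `t_{v,i}` is `1`. [folklore] -/
theorem fst_coe_heckeDiagEntry (ϖ : (v.adicCompletion K)ˣ) (i : ℕ) (k : Fin n) :
    ((heckeDiagEntry n K v ϖ i k : (AdeleRing (𝓞 K) K)ˣ) : AdeleRing (𝓞 K) K).1 = 1 := by
  unfold heckeDiagEntry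
  split_ifs <;> rfl

/-- The archimedean component of each diagonal entry of `t_{v,i}⁻¹` is `1`. [folklore] -/
theorem fst_coe_heckeDiagEntry_inv (ϖ : (v.adicCompletion K)ˣ) (i : ℕ) (k : Fin n) :
    (((heckeDiagEntry n K v ϖ i k)⁻¹ : (AdeleRing (𝓞 K) K)ˣ) : AdeleRing (𝓞 K) K).1 = 1 := by
  unfold heckeDiagEntry
  split_ifs <;> rfl

/-- The `v`-component of the `k`-th diagonal entry of `t_{v,i}` is `ϖ` for `k < i` and `1`
otherwise (`uniformizerIdele_apply_self`). [folklore] -/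
theorem adeleEval_coe_heckeDiagEntry_self (ϖ : (v.adicCompletion K)ˣ) (i : ℕ) (k : Fin n) :
    AdelicGroupData.adeleEval K v
        ((heckeDiagEntry n K v ϖ i k : (AdeleRing (𝓞 K) K)ˣ) : AdeleRing (𝓞 K) K) =
      if k.val < i then (ϖ : v.adicCompletion K) else 1 := by
  unfold heckeDiagEntry
  split_ifs
  · rw [AdelicGroupData.adeleEval_apply, Units.coe_map]
    exact uniformizerIdele_apply_self K v ϖ
  · rfl

/-- The `w`-component, `w ≠ v`, of each diagonal entry of `t_{v,i}` is `1`
(`uniformizerIdele_apply_of_ne`). [folklore] -/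
theorem adeleEval_coe_heckeDiagEntry_of_ne {w : HeightOneSpectrum (𝓞 K)} (h : w ≠ v)
    (ϖ : (v.adicCompletion K)ˣ) (i : ℕ) (k : Fin n) :
    AdelicGroupData.adeleEval K w
        ((heckeDiagEntry n K v ϖ i k : (AdeleRing (𝓞 K) K)ˣ) : AdeleRing (𝓞 K) K) = 1 := by
  unfold heckeDiagEntry
  split_ifs
  · rw [AdelicGroupData.adeleEval_apply, Units.coe_map]
    exact uniformizerIdele_apply_of_ne K v ϖ h
  · rfl

variable {n K v} in
/-- Entries of the conjugate: `(t_{v,i}⁻¹ k t_{v,i})_{ab} = d_a⁻¹ k_{ab} d_b` with `d` the diagonal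
of `t_{v,i}` (`Matrix.diagonal_mul`, `Matrix.mul_diagonal`). [folklore] -/
theorem coe_conj_heckeDiagAt_apply (ϖ : (v.adicCompletion K)ˣ) (i : ℕ)
    (k : GL (Fin n) (AdeleRing (𝓞 K) K)) (a b : Fin n) :
    (((heckeDiagAt n K v ϖ i)⁻¹ * k * heckeDiagAt n K v ϖ i : GL (Fin n) (AdeleRing (𝓞 K) K)) :
        Matrix (Fin n) (Fin n) (AdeleRing (𝓞 K) K)) a b =
      (((heckeDiagEntry n K v ϖ i a)⁻¹ : (AdeleRing (𝓞 K) K)ˣ) : AdeleRing (𝓞 K) K) *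
        (k : Matrix (Fin n) (Fin n) (AdeleRing (𝓞 K) K)) a b *
          ((heckeDiagEntry n K v ϖ i b : (AdeleRing (𝓞 K) K)ˣ) : AdeleRing (𝓞 K) K) := by
  rw [heckeDiagAt_eq_glDiagonal, ← map_inv, Units.val_mul, Units.val_mul, coe_glDiagonal,
    coe_glDiagonal, Matrix.mul_diagonal, Matrix.diagonal_mul, Pi.inv_apply]

/-- `(x y)_∞ = x_∞ y_∞` in `𝔸_K = K_∞ × 𝔸_K^∞` (definitional; recorded because `rw [Prod.fst_mul]`
does not see through the ring structure of `AdeleRing`). [folklore] -/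
theorem fst_mul_adele (x y : AdeleRing (𝓞 K) K) : (x * y).1 = x.1 * y.1 := rfl

/-- `t_{v,i}` has component `1` at every finite place `w ≠ v` (Bump §3.3). [folklore] -/
theorem map_adeleEval_heckeDiagAt_of_ne {w : HeightOneSpectrum (𝓞 K)} (h : w ≠ v)
    (ϖ : (v.adicCompletion K)ˣ) (i : ℕ) :
    Matrix.GeneralLinearGroup.map (AdelicGroupData.adeleEval K w) (heckeDiagAt n K v ϖ i) = 1 := by
  refine Matrix.GeneralLinearGroup.ext fun a b => ?_
  rw [AdelicGroupData.coe_map_adeleEval_apply, heckeDiagAt_eq_glDiagonal, coe_glDiagonal,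
    Matrix.diagonal_apply, Units.val_one, Matrix.one_apply]
  split_ifs
  · exact adeleEval_coe_heckeDiagEntry_of_ne n K v h ϖ i a
  · exact map_zero _

variable {n K v} in
/-- The `v`-component of `t_{v,i}⁻¹ k t_{v,i}` has entries `ϖ^{-[a < i]} (k_v)_{ab} ϖ^{[b < i]}`.
[folklore] -/
theorem coe_map_adeleEval_conj_heckeDiagAt_apply (ϖ : (v.adicCompletion K)ˣ) (i : ℕ)
    (k : GL (Fin n) (AdeleRing (𝓞 K) K)) (a b : Fin n) :
    (Matrix.GeneralLinearGroup.map (AdelicGroupData.adeleEval K v)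
        ((heckeDiagAt n K v ϖ i)⁻¹ * k * heckeDiagAt n K v ϖ i) :
        Matrix (Fin n) (Fin n) (v.adicCompletion K)) a b =
      (if a.val < i then (ϖ : v.adicCompletion K) else 1)⁻¹ *
        AdelicGroupData.adeleEval K v ((k : Matrix (Fin n) (Fin n) (AdeleRing (𝓞 K) K)) a b) *
          (if b.val < i then (ϖ : v.adicCompletion K) else 1) := by
  rw [AdelicGroupData.coe_map_adeleEval_apply, coe_conj_heckeDiagAt_apply, map_mul, map_mul,
    map_units_inv, adeleEval_coe_heckeDiagEntry_self, adeleEval_coe_heckeDiagEntry_self]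

variable {n K v} in
/-- **`(t_{v,i}⁻¹ k t_{v,i})_v ∈ GL_n(𝒪_v)`** for `k ∈ K^max` whose `v`-component, and that of
`k⁻¹`, have off-diagonal entries of valuation `≤ |ϖ|` (and `|ϖ| ≤ 1`): both the conjugate and
its inverse `t⁻¹ k⁻¹ t` have integral entries by `valuation_diag_conj_apply_le_one`
(Shimura, Ch. 3). [folklore] -/
theorem map_adeleEval_conj_heckeDiagAt_mem_valuedCongruenceSubgroup_one
    {ϖ : (v.adicCompletion K)ˣ} (hϖ : Valued.v (ϖ : v.adicCompletion K) ≤ 1) (i : ℕ)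
    {k : GL (Fin n) (AdeleRing (𝓞 K) K)} (hk : k ∈ glIntegralLevel n K)
    (hsmall : ∀ a b : Fin n, a ≠ b →
      Valued.v (AdelicGroupData.adeleEval K v ((k : Matrix (Fin n) (Fin n) (AdeleRing (𝓞 K) K)) a b))
        ≤ Valued.v (ϖ : v.adicCompletion K))
    (hsmall' : ∀ a b : Fin n, a ≠ b →
      Valued.v (AdelicGroupData.adeleEval K v
        (((k⁻¹ : GL (Fin n) (AdeleRing (𝓞 K) K)) : Matrix (Fin n) (Fin n) (AdeleRing (𝓞 K) K)) a b))
        ≤ Valued.v (ϖ : v.adicCompletion K)) :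
    Matrix.GeneralLinearGroup.map (AdelicGroupData.adeleEval K v)
        ((heckeDiagAt n K v ϖ i)⁻¹ * k * heckeDiagAt n K v ϖ i) ∈
      valuedCongruenceSubgroup (Fin n) (1 : WithZero (Multiplicative ℤ)) := by
  set t := heckeDiagAt n K v ϖ i with ht
  have hϖ0 : ((ϖ : v.adicCompletion K)) ≠ 0 := ϖ.ne_zero
  have hint := toLocal_mem_valuedCongruenceSubgroup_one hk v
  change Matrix.GeneralLinearGroup.map (AdelicGroupData.adeleEval K v) k ∈ _ at hint
  obtain ⟨hk1, hk2, -⟩ := hint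
  rw [← map_inv] at hk2
  -- entry estimate for any `k'` with integral entries and small off-diagonal entries at `v`
  have key : ∀ k' : GL (Fin n) (AdeleRing (𝓞 K) K),
      (∀ a b : Fin n, Valued.v (AdelicGroupData.adeleEval K v
        ((k' : Matrix (Fin n) (Fin n) (AdeleRing (𝓞 K) K)) a b)) ≤ 1) →
      (∀ a b : Fin n, a ≠ b → Valued.v (AdelicGroupData.adeleEval K v
        ((k' : Matrix (Fin n) (Fin n) (AdeleRing (𝓞 K) K)) a b)) ≤
          Valued.v (ϖ : v.adicCompletion K)) →
      ∀ a b : Fin n, Valued.v ((Matrix.GeneralLinearGroup.map (AdelicGroupData.adeleEval K v)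
        (t⁻¹ * k' * t) : Matrix (Fin n) (Fin n) (v.adicCompletion K)) a b) ≤ 1 := by
    intro k' h1 h2 a b
    rw [ht, coe_map_adeleEval_conj_heckeDiagAt_apply]
    exact valuation_diag_conj_apply_le_one (fun c : Fin n => c.val < i) hϖ0 hϖ
      (M := fun a b => AdelicGroupData.adeleEval K v
        ((k' : Matrix (Fin n) (Fin n) (AdeleRing (𝓞 K) K)) a b)) h1 h2 a b
  have hent := key k hk1 hsmall
  have hent' : ∀ a b : Fin n, Valued.v ((((Matrix.GeneralLinearGroup.map
      (AdelicGroupData.adeleEval K v) (t⁻¹ * k * t))⁻¹ : GL (Fin n) (v.adicCompletion K)) :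
        Matrix (Fin n) (Fin n) (v.adicCompletion K)) a b) ≤ 1 := by
    have hrw : (t⁻¹ * k * t)⁻¹ = t⁻¹ * k⁻¹ * t := by group
    rw [← map_inv, hrw]
    exact key k⁻¹ hk2 hsmall'
  exact ⟨hent, hent', valuation_sub_one_apply_le_one_of_forall hent⟩

variable {n K v} in
/-- **`t_{v,i}⁻¹ k t_{v,i} ∈ K(𝔫)`** for `v ∤ 𝔫 ≠ 0`, `|ϖ| ≤ 1`, and `k ∈ K(𝔫)` such that the
off-diagonal entries of `k_v` and `k_v⁻¹` have valuation `≤ |ϖ|`: at `w ≠ v` the conjugate has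
the same component as `k` (`t_{v,i}` is `1` there), at `v` the level condition is `GL_n(𝒪_v)`
(`idealRadius_eq_one_of_not_dvd`) and holds by
`map_adeleEval_conj_heckeDiagAt_mem_valuedCongruenceSubgroup_one`, and the archimedean
component is that of `k`, i.e. `1` (Shimura, Ch. 3; Bump §3.3: `K t_{v,i} K / K` is a
`GL_n(𝒪_v)`-computation). [folklore] -/
theorem conj_heckeDiagAt_mem_principalCongruenceLevel {𝔫 : Ideal (𝓞 K)} (h𝔫 : 𝔫 ≠ 0)
    (hv : ¬ v.asIdeal ∣ 𝔫) {ϖ : (v.adicCompletion K)ˣ} (hϖ : Valued.v (ϖ : v.adicCompletion K) ≤ 1)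
    (i : ℕ) {k : GL (Fin n) (AdeleRing (𝓞 K) K)} (hk : k ∈ principalCongruenceLevel n K 𝔫)
    (hsmall : ∀ a b : Fin n, a ≠ b →
      Valued.v (AdelicGroupData.adeleEval K v ((k : Matrix (Fin n) (Fin n) (AdeleRing (𝓞 K) K)) a b))
        ≤ Valued.v (ϖ : v.adicCompletion K))
    (hsmall' : ∀ a b : Fin n, a ≠ b →
      Valued.v (AdelicGroupData.adeleEval K v
        (((k⁻¹ : GL (Fin n) (AdeleRing (𝓞 K) K)) : Matrix (Fin n) (Fin n) (AdeleRing (𝓞 K) K)) a b))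
        ≤ Valued.v (ϖ : v.adicCompletion K)) :
    (heckeDiagAt n K v ϖ i)⁻¹ * k * heckeDiagAt n K v ϖ i ∈ principalCongruenceLevel n K 𝔫 := by
  rw [mem_principalCongruenceLevel_iff] at hk ⊢
  obtain ⟨hkI, hkv⟩ := hk
  set g := (heckeDiagAt n K v ϖ i)⁻¹ * k * heckeDiagAt n K v ϖ i with hg
  -- local conditions at every finite place
  have hloc : ∀ w : HeightOneSpectrum (𝓞 K),
      Matrix.GeneralLinearGroup.map (AdelicGroupData.adeleEval K w) g ∈
        valuedCongruenceSubgroup (Fin n) (idealRadius K w 𝔫) := by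
    intro w
    by_cases hw : w = v
    · subst hw
      rw [idealRadius_eq_one_of_not_dvd h𝔫 hv]
      exact map_adeleEval_conj_heckeDiagAt_mem_valuedCongruenceSubgroup_one hϖ i hkI hsmall hsmall'
    · rw [hg, map_mul, map_mul, map_inv, map_adeleEval_heckeDiagAt_of_ne n K v hw, inv_one,
        one_mul, mul_one]
      exact hkv w
  refine ⟨?_, hloc⟩
  rw [mem_glIntegralLevel_iff'] at hkI ⊢
  refine ⟨⟨fun a b w => ?_, fun a b w => ?_⟩, fun a b => ?_⟩
  · exact (HeightOneSpectrum.mem_adicCompletionIntegers (R := 𝓞 K) K w).mpr ((hloc w).1 a b)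
  · have h := (hloc w).2.1 a b
    rw [← map_inv] at h
    exact (HeightOneSpectrum.mem_adicCompletionIntegers (R := 𝓞 K) K w).mpr h
  · rw [hg, coe_conj_heckeDiagAt_apply, fst_mul_adele, fst_mul_adele,
      fst_coe_heckeDiagEntry, fst_coe_heckeDiagEntry_inv, hkI.2 a b, one_mul, mul_one]

end Conjugation


/-! ### The size of the double coset `K(𝔫) t_{v,i} K(𝔫) / K(𝔫)` -/

section OrbitBound

variable (n : ℕ) (K : Type) [Field K] [NumberField K] (v : HeightOneSpectrum (𝓞 K))

/-- In `ℤᵐ⁰`, `x < 1 = exp 0` implies `x ≤ exp (-1)` (discreteness; Mathlib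
`WithZero.lt_mul_exp_iff_le`). [folklore] -/
theorem withZero_le_exp_neg_one_of_lt_one {x : WithZero (Multiplicative ℤ)} (hx : x < 1) :
    x ≤ WithZero.exp (-1 : ℤ) := by
  rw [← WithZero.lt_mul_exp_iff_le WithZero.exp_ne_zero, ← WithZero.exp_add]
  simpa using hx

/-- The `v`-component `Kf →* GL_n(𝒪_v)` of a level `Kf ≤ K^max` (`toLocal_mem_valuedCongruenceSubgroup_one`,
bundled with `MonoidHom.codRestrict`; Bump §3.3). [folklore] -/
def levelToLocalIntegral (Kf : Subgroup (GL (Fin n) (AdeleRing (𝓞 K) K)))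
    (hKf : Kf ≤ glIntegralLevel n K) :
    Kf →* valuedCongruenceSubgroup (F := v.adicCompletion K) (Fin n)
      (1 : WithZero (Multiplicative ℤ)) :=
  ((Matrix.GeneralLinearGroup.map (AdelicGroupData.adeleEval K v)).comp Kf.subtype).codRestrict _
    fun k => toLocal_mem_valuedCongruenceSubgroup_one (hKf k.2) v

/-- `levelToLocalIntegral` is `GL_n(𝔸_K) → GL_n(K_v)` restricted to `Kf` (definitional). [folklore] -/
theorem coe_levelToLocalIntegral_apply (Kf : Subgroup (GL (Fin n) (AdeleRing (𝓞 K) K)))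
    (hKf : Kf ≤ glIntegralLevel n K) (k : Kf) :
    ((levelToLocalIntegral n K v Kf hKf k : valuedCongruenceSubgroup (F := v.adicCompletion K) (Fin n)
      (1 : WithZero (Multiplicative ℤ))) : GL (Fin n) (v.adicCompletion K)) =
      Matrix.GeneralLinearGroup.map (AdelicGroupData.adeleEval K v) (k : GL (Fin n) (AdeleRing (𝓞 K) K)) :=
  rfl

/-- **Reduction of a level modulo `𝓂_v`**: the group homomorphism `Kf →* GL_n(𝓀_v)` (units of
`M_n(𝓀_v)`), `k ↦ (k_v mod 𝓂_v)`, for a level `Kf ≤ K^max` (`reductionHom ∘ levelToLocalIntegral`,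
made unit-valued by `MonoidHom.toHomUnits`; Shimura, Ch. 3; Bump §3.3). [folklore] -/
def levelReduction (Kf : Subgroup (GL (Fin n) (AdeleRing (𝓞 K) K)))
    (hKf : Kf ≤ glIntegralLevel n K) :
    Kf →* (Matrix (Fin n) (Fin n) 𝓀[v.adicCompletion K])ˣ :=
  ((reductionHom (Fin n)).comp (levelToLocalIntegral n K v Kf hKf)).toHomUnits

variable {n K v} in
/-- For `k` in the kernel of the reduction modulo `𝓂_v`, the off-diagonal entries of `k_v` have
valuation `≤ exp (-1)` (i.e. lie in `𝓂_v`). [folklore] -/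
theorem valuation_adeleEval_apply_le_of_mem_ker_levelReduction
    {Kf : Subgroup (GL (Fin n) (AdeleRing (𝓞 K) K))} {hKf : Kf ≤ glIntegralLevel n K} {k : Kf}
    (hk : k ∈ (levelReduction n K v Kf hKf).ker) {a b : Fin n} (hab : a ≠ b) :
    Valued.v (AdelicGroupData.adeleEval K v
      (((k : GL (Fin n) (AdeleRing (𝓞 K) K)) : Matrix (Fin n) (Fin n) (AdeleRing (𝓞 K) K)) a b)) ≤
      WithZero.exp (-1 : ℤ) := by
  rw [levelReduction, MonoidHom.ker_toHomUnits, MonoidHom.mem_ker, MonoidHom.comp_apply] at hk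
  exact withZero_le_exp_neg_one_of_lt_one
    (valuation_apply_lt_one_of_reductionHom_eq_one (Fin n) hk hab)

variable {n K v} in
/-- **The kernel of reduction modulo `𝓂_v` stabilises the coset `t_{v,i} K(𝔫)`** (`v ∤ 𝔫 ≠ 0`,
`ϖ` a uniformizer): for `k ≡ 1 (mod 𝓂_v)` in `K(𝔫)`, `k t_{v,i} K(𝔫) = t_{v,i} K(𝔫)` since
`t_{v,i}⁻¹ k⁻¹ t_{v,i} ∈ K(𝔫)` (`conj_heckeDiagAt_mem_principalCongruenceLevel` applied to `k⁻¹`,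
also in the kernel). [folklore] -/
theorem ker_levelReduction_le_stabilizer {𝔫 : Ideal (𝓞 K)} (h𝔫 : 𝔫 ≠ 0)
    (hv : ¬ v.asIdeal ∣ 𝔫) {ϖ : (v.adicCompletion K)ˣ}
    (hϖ : Valued.v (ϖ : v.adicCompletion K) = WithZero.exp (-1 : ℤ)) (i : ℕ) :
    (levelReduction n K v (principalCongruenceLevel n K 𝔫) (principalCongruenceLevel_le n K 𝔫)).ker ≤
      MulAction.stabilizer (principalCongruenceLevel n K 𝔫)
        ((heckeDiagAt n K v ϖ i : GL (Fin n) (AdeleRing (𝓞 K) K)) :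
          GL (Fin n) (AdeleRing (𝓞 K) K) ⧸ principalCongruenceLevel n K 𝔫) := by
  intro k hk
  have hk' : k⁻¹ ∈ (levelReduction n K v (principalCongruenceLevel n K 𝔫)
      (principalCongruenceLevel_le n K 𝔫)).ker := inv_mem hk
  have hϖ1 : Valued.v (ϖ : v.adicCompletion K) ≤ 1 := by
    rw [hϖ, ← WithZero.exp_zero, WithZero.exp_le_exp]
    norm_num
  rw [MulAction.mem_stabilizer_iff]
  have hq : k • ((heckeDiagAt n K v ϖ i : GL (Fin n) (AdeleRing (𝓞 K) K)) :
      GL (Fin n) (AdeleRing (𝓞 K) K) ⧸ principalCongruenceLevel n K 𝔫) =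
      ((((k : GL (Fin n) (AdeleRing (𝓞 K) K)) * heckeDiagAt n K v ϖ i :
        GL (Fin n) (AdeleRing (𝓞 K) K)) : GL (Fin n) (AdeleRing (𝓞 K) K) ⧸
          principalCongruenceLevel n K 𝔫)) := rfl
  rw [hq, QuotientGroup.eq]
  have hrw : ((k : GL (Fin n) (AdeleRing (𝓞 K) K)) * heckeDiagAt n K v ϖ i)⁻¹ *
      heckeDiagAt n K v ϖ i =
      (heckeDiagAt n K v ϖ i)⁻¹ * ((k⁻¹ : principalCongruenceLevel n K 𝔫) :
        GL (Fin n) (AdeleRing (𝓞 K) K)) * heckeDiagAt n K v ϖ i := by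
    rw [Subgroup.coe_inv]
    group
  rw [hrw]
  refine conj_heckeDiagAt_mem_principalCongruenceLevel h𝔫 hv hϖ1 i (k⁻¹).2
    (fun a b hab => ?_) (fun a b hab => ?_)
  · rw [hϖ]
    exact valuation_adeleEval_apply_le_of_mem_ker_levelReduction hk' hab
  · rw [hϖ, Subgroup.coe_inv, inv_inv]
    exact valuation_adeleEval_apply_le_of_mem_ker_levelReduction hk hab

/-- `#M_n(𝓀_v) ≤ q_v^{n²}` (`Nat.card_fun` and `#𝓀_v ≤ q_v`). [folklore] -/
theorem natCard_matrix_residueField_le :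
    Nat.card (Matrix (Fin n) (Fin n) 𝓀[v.adicCompletion K]) ≤ v.residueCard ^ (n ^ 2) := by
  haveI : Finite 𝓀[v.adicCompletion K] := finite_residueField_adicCompletion K v
  have hfin : Nat.card (Fin n) = n := by simp
  rw [show Matrix (Fin n) (Fin n) 𝓀[v.adicCompletion K] = (Fin n → Fin n → 𝓀[v.adicCompletion K])
    from rfl, Nat.card_fun, Nat.card_fun, hfin, ← pow_mul, ← sq]
  exact Nat.pow_le_pow_left (natCard_residueField_adicCompletion_le_residueCard K v) _

variable {n K v} in
/-- **Degree bound for `T_{v,i}`:** `#(K(𝔫) t_{v,i} K(𝔫) / K(𝔫)) ≤ q_v^{n²}` for `v ∤ 𝔫 ≠ 0` and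
`ϖ` a uniformizer. The orbit of the coset `t_{v,i} K(𝔫)` under `K(𝔫)` has `[K(𝔫) : Stab]`
elements (`MulAction.index_stabilizer`); the stabiliser contains the kernel of `levelReduction`
(`ker_levelReduction_le_stabilizer`), whose index is the order of its image in `GL_n(𝓀_v)`
(`Subgroup.index_ker`), at most `#M_n(𝓀_v) ≤ q_v^{n²}`. (The exact value is the Gaussian
binomial coefficient `[n choose i]_{q_v}`, Shimura, Ch. 3 / Bump §3.3 / Tamagawa; only this
crude bound is needed.) [folklore] -/
theorem ncard_orbit_heckeDiagAt_le {𝔫 : Ideal (𝓞 K)} (h𝔫 : 𝔫 ≠ 0) (hv : ¬ v.asIdeal ∣ 𝔫)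
    {ϖ : (v.adicCompletion K)ˣ} (hϖ : Valued.v (ϖ : v.adicCompletion K) = WithZero.exp (-1 : ℤ))
    (i : ℕ) :
    (MulAction.orbit (principalCongruenceLevel n K 𝔫)
      ((heckeDiagAt n K v ϖ i : GL (Fin n) (AdeleRing (𝓞 K) K)) :
        GL (Fin n) (AdeleRing (𝓞 K) K) ⧸ principalCongruenceLevel n K 𝔫)).ncard ≤
      v.residueCard ^ (n ^ 2) := by
  haveI : Finite 𝓀[v.adicCompletion K] := finite_residueField_adicCompletion K v
  haveI : Finite (Matrix (Fin n) (Fin n) 𝓀[v.adicCompletion K]) :=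
    inferInstanceAs (Finite (Fin n → Fin n → 𝓀[v.adicCompletion K]))
  set Φ := levelReduction n K v (principalCongruenceLevel n K 𝔫) (principalCongruenceLevel_le n K 𝔫)
    with hΦ
  have hrange : Nat.card Φ.range ≤ v.residueCard ^ (n ^ 2) :=
    calc Nat.card Φ.range ≤ Nat.card (Matrix (Fin n) (Fin n) 𝓀[v.adicCompletion K])ˣ :=
          Nat.card_le_card_of_injective _ Subtype.val_injective
      _ ≤ Nat.card (Matrix (Fin n) (Fin n) 𝓀[v.adicCompletion K]) :=
          Nat.card_le_card_of_injective _ Units.val_injective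
      _ ≤ v.residueCard ^ (n ^ 2) := natCard_matrix_residueField_le n K v
  haveI : Φ.ker.FiniteIndex := ⟨by rw [Subgroup.index_ker]; exact Nat.card_pos.ne'⟩
  rw [← MulAction.index_stabilizer]
  calc (MulAction.stabilizer (principalCongruenceLevel n K 𝔫)
        ((heckeDiagAt n K v ϖ i : GL (Fin n) (AdeleRing (𝓞 K) K)) :
          GL (Fin n) (AdeleRing (𝓞 K) K) ⧸ principalCongruenceLevel n K 𝔫)).index
        ≤ Φ.ker.index := Subgroup.index_antitone (ker_levelReduction_le_stabilizer h𝔫 hv hϖ i)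
    _ = Nat.card Φ.range := Subgroup.index_ker Φ
    _ ≤ v.residueCard ^ (n ^ 2) := hrange

variable {n K v} in
/-- The orbit of the coset `t_{v,i} K(𝔫)` under `K(𝔫)` is **finite** for `v ∤ 𝔫 ≠ 0` (its
stabiliser contains the kernel of `levelReduction`, which has finite index), so that the bound
`ncard_orbit_heckeDiagAt_le` is a genuine count and not the junk value `Set.ncard = 0` of an
infinite set. [folklore] -/
theorem finite_orbit_heckeDiagAt {𝔫 : Ideal (𝓞 K)} (h𝔫 : 𝔫 ≠ 0) (hv : ¬ v.asIdeal ∣ 𝔫)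
    {ϖ : (v.adicCompletion K)ˣ} (hϖ : Valued.v (ϖ : v.adicCompletion K) = WithZero.exp (-1 : ℤ))
    (i : ℕ) :
    (MulAction.orbit (principalCongruenceLevel n K 𝔫)
      ((heckeDiagAt n K v ϖ i : GL (Fin n) (AdeleRing (𝓞 K) K)) :
        GL (Fin n) (AdeleRing (𝓞 K) K) ⧸ principalCongruenceLevel n K 𝔫)).Finite := by
  haveI : Finite 𝓀[v.adicCompletion K] := finite_residueField_adicCompletion K v
  haveI : Finite (Matrix (Fin n) (Fin n) 𝓀[v.adicCompletion K]) :=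
    inferInstanceAs (Finite (Fin n → Fin n → 𝓀[v.adicCompletion K]))
  set Φ := levelReduction n K v (principalCongruenceLevel n K 𝔫) (principalCongruenceLevel_le n K 𝔫)
    with hΦ
  haveI : Φ.ker.FiniteIndex := ⟨by rw [Subgroup.index_ker]; exact Nat.card_pos.ne'⟩
  haveI : (MulAction.stabilizer (principalCongruenceLevel n K 𝔫)
      ((heckeDiagAt n K v ϖ i : GL (Fin n) (AdeleRing (𝓞 K) K)) :
        GL (Fin n) (AdeleRing (𝓞 K) K) ⧸ principalCongruenceLevel n K 𝔫)).FiniteIndex :=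
    Subgroup.finiteIndex_of_le (ker_levelReduction_le_stabilizer h𝔫 hv hϖ i)
  exact Set.finite_coe_iff.mp
    (Finite.of_equiv _ (MulAction.orbitEquivQuotientStabilizer (principalCongruenceLevel n K 𝔫)
      ((heckeDiagAt n K v ϖ i : GL (Fin n) (AdeleRing (𝓞 K) K)) :
        GL (Fin n) (AdeleRing (𝓞 K) K) ⧸ principalCongruenceLevel n K 𝔫)).symm)

end OrbitBound


/-! ### Hecke eigenvalues are bounded by the size of the double coset -/

section HeckeBound

variable {G V : Type*} [Group G] [NormedAddCommGroup V] [NormedSpace ℂ V]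
  (ρ : Representation ℂ G V)

/-- If the double coset `KgK/K` is infinite, the (junk) Hecke operator `[KgK]` is `0` (a copy of
`heckeOperator_eq_zero_of_infinite` of `JacquetLanglandsParts`, kept private to avoid the
import). [folklore] -/
private theorem heckeOperator_eq_zero_of_infinite_orbit (K : Subgroup G) (g : G)
    (hK : (MulAction.orbit K (g : G ⧸ K)).Infinite) : heckeOperator ρ K g = 0 := by
  rcases subsingleton_or_nontrivial V with hV | hV
  · exact LinearMap.ext fun v => Subsingleton.elim _ _
  rw [heckeOperator]
  apply finsum_mem_eq_zero_of_infinite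
  rw [Set.inter_eq_self_of_subset_left]
  · exact hK
  · intro y _
    rw [Function.mem_support]
    intro h0
    obtain ⟨w, hw⟩ := exists_ne (0 : V)
    apply hw
    have : ρ (y.out)⁻¹ (ρ y.out w) = w := by
      rw [← Module.End.mul_apply, ← map_mul, inv_mul_cancel, map_one, Module.End.one_apply]
    rw [← this, h0, LinearMap.zero_apply, map_zero]

/-- **Hecke eigenvalues are bounded by the degree of the double coset.** If `ρ` acts by
contractions of a normed space (`‖ρ g v‖ ≤ ‖v‖`, e.g. a unitary representation) and
`[KgK] v = c • v` for a non-zero `v`, then `|c| ≤ #(KgK/K)`: `[KgK] = ∑_{yK ⊆ KgK} ρ(y)` is a sum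
of `#(KgK/K)` contractions (`heckeOperator`, `finsum` over the orbit), and if `KgK/K` is
infinite the operator is the junk value `0`, so `c = 0` (the "trivial bound" for Hecke
eigenvalues of `L²`-eigenforms; Shimura, Ch. 3; Bump §3.4). [folklore] -/
theorem norm_le_ncard_orbit_of_heckeOperator_apply_eq_smul (hρ : ∀ (g : G) (v : V), ‖ρ g v‖ ≤ ‖v‖)
    (K : Subgroup G) (g : G) {v : V} (hv : v ≠ 0) {c : ℂ}
    (h : heckeOperator ρ K g v = c • v) :
    ‖c‖ ≤ (MulAction.orbit K (g : G ⧸ K)).ncard := by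
  by_cases hfin : (MulAction.orbit K (g : G ⧸ K)).Finite
  · have hsum : heckeOperator ρ K g v = ∑ y ∈ hfin.toFinset, ρ y.out v := by
      rw [heckeOperator, finsum_mem_eq_finite_toFinset_sum _ hfin, LinearMap.sum_apply]
    have h1 : ‖c‖ * ‖v‖ ≤ (MulAction.orbit K (g : G ⧸ K)).ncard * ‖v‖ := by
      calc ‖c‖ * ‖v‖ = ‖heckeOperator ρ K g v‖ := by rw [h, norm_smul]
        _ = ‖∑ y ∈ hfin.toFinset, ρ y.out v‖ := by rw [hsum]
        _ ≤ ∑ y ∈ hfin.toFinset, ‖ρ y.out v‖ := norm_sum_le _ _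
        _ ≤ ∑ y ∈ hfin.toFinset, ‖v‖ := Finset.sum_le_sum fun y _ => hρ _ _
        _ = (MulAction.orbit K (g : G ⧸ K)).ncard * ‖v‖ := by
            rw [Finset.sum_const, nsmul_eq_mul, Set.ncard_eq_toFinset_card _ hfin]
    exact le_of_mul_le_mul_right h1 (norm_pos_iff.mpr hv)
  · have h0 : heckeOperator ρ K g = 0 := Literature.NumberTheory.Automorphic.heckeOperator_eq_zero_of_infinite_orbit ρ K g hfin
    rw [h0, LinearMap.zero_apply, eq_comm, smul_eq_zero] at h
    rcases h with h | h
    · rw [h, norm_zero]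
      exact Nat.cast_nonneg _
    · exact absurd h hv

end HeckeBound

/-! ### Cauchy's bound for the members of a multiset from its elementary symmetric functions -/

section Cauchy

open Polynomial in
/-- **Cauchy's bound via the elementary symmetric functions.** If `‖e_j(α)‖ ≤ B` for all
`j ≤ card α` (so `B ≥ ‖e_0‖ = 1`) then every `a ∈ α` has `‖a‖ ≤ B + 1`: `a` is a root of the monic
polynomial
`∏_{t ∈ α} (X - t) = ∑_j (-1)^j e_j(α) X^{card α - j}` (Mathlib `Multiset.prod_X_sub_C_coeff`),
whose Cauchy bound is `max_j ‖e_j‖ + 1` (Mathlib `Polynomial.IsRoot.norm_lt_cauchyBound`).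
[folklore] -/
theorem norm_le_of_forall_norm_esymm_le {α : Multiset ℂ} {B : ℝ}
    (h : ∀ j, j ≤ Multiset.card α → ‖α.esymm j‖ ≤ B) {a : ℂ} (ha : a ∈ α) : ‖a‖ ≤ B + 1 := by
  have hB : 0 ≤ B := by
    have h0 := h 0 (Nat.zero_le _)
    have he : α.esymm 0 = 1 := by simp [Multiset.esymm, Multiset.powersetCard_zero_left]
    rw [he, norm_one] at h0
    exact zero_le_one.trans h0
  set p : ℂ[X] := (α.map fun t => X - C t).prod with hp_def
  have hp : p.Monic := monic_multisetProd_X_sub_C α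
  have hp0 : p ≠ 0 := hp.ne_zero
  have hroot : p.IsRoot a := by
    rw [IsRoot.def, hp_def, eval_multiset_prod, Multiset.prod_eq_zero_iff]
    exact Multiset.mem_map.mpr ⟨X - C a, Multiset.mem_map.mpr ⟨a, ha, rfl⟩, by simp⟩
  have hlt := hroot.norm_lt_cauchyBound hp0
  have hdeg : p.natDegree = Multiset.card α := natDegree_multiset_prod_X_sub_C_eq_card α
  have hsup : (Finset.range p.natDegree).sup (fun k => ‖p.coeff k‖₊) ≤ ⟨B, hB⟩ := by
    refine Finset.sup_le fun k hk => ?_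
    rw [Finset.mem_range, hdeg] at hk
    rw [hp_def, Multiset.prod_X_sub_C_coeff α hk.le, nnnorm_mul, nnnorm_pow, nnnorm_neg, nnnorm_one,
      one_pow, one_mul, ← NNReal.coe_le_coe, coe_nnnorm]
    exact h _ (Nat.sub_le _ _)
  have hcb : p.cauchyBound ≤ ⟨B, hB⟩ + 1 := by
    rw [Polynomial.cauchyBound, hp.leadingCoeff, nnnorm_one, div_one]
    exact add_le_add hsup le_rfl
  have := hlt.le.trans hcb
  rw [← NNReal.coe_le_coe, coe_nnnorm, NNReal.coe_add, NNReal.coe_one] at this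
  exact this

end Cauchy

/-! ### The trivial bound on Hecke–Satake parameters -/

section TrivialBound

variable {n : ℕ} {K : Type} [Field K] [NumberField K]
  {μ : Measure (AdelicGroupData.gl n K).automorphicQuotient}
  [SMulInvariantMeasure (AdelicGroupData.gl n K).Adelic (AdelicGroupData.gl n K).automorphicQuotient μ]

/-- The regular representation restricted to a closed subrepresentation `W ≤ L²` acts by
isometries (`norm_rightRegular_apply`). [folklore] -/
theorem norm_toContRep_apply
    (W : ContRepresentation.ClosedSubrep ((AdelicGroupData.gl n K).rightRegular μ))
    (g : GL (Fin n) (AdeleRing (𝓞 K) K)) (f : W.toSubmodule) :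
    ‖W.toContRep g f‖ = ‖f‖ := by
  rw [Submodule.coe_norm, ContRepresentation.ClosedSubrep.coe_toContRep_apply,
    AdelicGroupData.norm_rightRegular_apply, ← Submodule.coe_norm]

/-- **Trivial bound for the Hecke eigenvalues `q_v^{j(n-j)/2} e_j(α)`** recorded by
`HasSatakeParameterAt W K(𝔫) v ϖ α` (`v ∤ 𝔫 ≠ 0`): they have absolute value `≤ q_v^{n²}`
(`norm_le_ncard_orbit_of_heckeOperator_apply_eq_smul` and `ncard_orbit_heckeDiagAt_le`).
[folklore] -/
theorem norm_heckeEigenvalue_le_of_hasSatakeParameterAt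
    {W : ContRepresentation.ClosedSubrep ((AdelicGroupData.gl n K).rightRegular μ)}
    {𝔫 : Ideal (𝓞 K)} (h𝔫 : 𝔫 ≠ 0) {v : HeightOneSpectrum (𝓞 K)} (hv : ¬ v.asIdeal ∣ 𝔫)
    {ϖ : (v.adicCompletion K)ˣ} {α : Multiset ℂ}
    (h : HasSatakeParameterAt W (principalCongruenceLevel n K 𝔫) v ϖ α) {j : ℕ} (hj : j ≤ n) :
    ‖(((Real.sqrt (v.residueCard : ℝ) : ℝ) : ℂ) ^ (j * (n - j)) * α.esymm j)‖ ≤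
      (v.residueCard : ℝ) ^ (n ^ 2) := by
  obtain ⟨hϖ, -, f, -, hf0, heig⟩ := h
  have h1 := norm_le_ncard_orbit_of_heckeOperator_apply_eq_smul W.toContRep.toRepresentation
    (fun g f => (norm_toContRep_apply W g f).le)
    (principalCongruenceLevel n K 𝔫) (heckeDiagAt n K v ϖ j) hf0 (heig j hj)
  refine h1.trans ?_
  exact_mod_cast ncard_orbit_heckeDiagAt_le h𝔫 hv hϖ j

/-- Hence `‖e_j(α)‖ ≤ q_v^{n²}` for the Hecke–Satake parameter `α` (`q_v^{j(n-j)/2} ≥ 1`). [folklore] -/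
theorem norm_esymm_le_of_hasSatakeParameterAt
    {W : ContRepresentation.ClosedSubrep ((AdelicGroupData.gl n K).rightRegular μ)}
    {𝔫 : Ideal (𝓞 K)} (h𝔫 : 𝔫 ≠ 0) {v : HeightOneSpectrum (𝓞 K)} (hv : ¬ v.asIdeal ∣ 𝔫)
    {ϖ : (v.adicCompletion K)ˣ} {α : Multiset ℂ}
    (h : HasSatakeParameterAt W (principalCongruenceLevel n K 𝔫) v ϖ α) {j : ℕ} (hj : j ≤ n) :
    ‖α.esymm j‖ ≤ (v.residueCard : ℝ) ^ (n ^ 2) := by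
  refine le_trans ?_ (norm_heckeEigenvalue_le_of_hasSatakeParameterAt h𝔫 hv h hj)
  rw [norm_mul, norm_pow, Complex.norm_real, Real.norm_of_nonneg (Real.sqrt_nonneg _)]
  refine le_mul_of_one_le_left (norm_nonneg _) (one_le_pow₀ ?_)
  rw [Real.one_le_sqrt]
  exact_mod_cast v.one_lt_residueCard.le

/-- **The trivial bound on Hecke–Satake parameters, level form:** if `W ≤ L²(GL_n(K) A_G \
GL_n(𝔸_K))` has Satake parameter `α` at `v` with respect to `K(𝔫)`, `v ∤ 𝔫 ≠ 0`, then every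
`a ∈ α` satisfies `‖a‖ ≤ q_v^{n²} + 1` (`norm_esymm_le_of_hasSatakeParameterAt` and Cauchy's bound
`norm_le_of_forall_norm_esymm_le`). [folklore] -/
theorem norm_le_of_hasSatakeParameterAt
    {W : ContRepresentation.ClosedSubrep ((AdelicGroupData.gl n K).rightRegular μ)}
    {𝔫 : Ideal (𝓞 K)} (h𝔫 : 𝔫 ≠ 0) {v : HeightOneSpectrum (𝓞 K)} (hv : ¬ v.asIdeal ∣ 𝔫)
    {ϖ : (v.adicCompletion K)ˣ} {α : Multiset ℂ}
    (h : HasSatakeParameterAt W (principalCongruenceLevel n K 𝔫) v ϖ α) {a : ℂ} (ha : a ∈ α) :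
    ‖a‖ ≤ (v.residueCard : ℝ) ^ (n ^ 2) + 1 := by
  have hcard : Multiset.card α = n := h.card_eq
  exact norm_le_of_forall_norm_esymm_le
    (fun j hj => norm_esymm_le_of_hasSatakeParameterAt h𝔫 hv h (hcard ▸ hj)) ha

end TrivialBound

section TrivialBoundCuspidal

variable {n : ℕ} {K : Type} [Field K] [NumberField K]
  {μ : Measure (AdelicGroupData.gl n K).automorphicQuotient}
  [(AdelicGroupData.gl n K).IsAutomorphicMeasure μ]

/-- **The trivial bound on Hecke–Satake parameters.** For a Satake family `α` of a cuspidal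
automorphic representation `Π` of `GL_n(𝔸_K)` away from `S` (`IsSatakeFamilyOf`), every `a ∈ α v`,
`v ∉ S`, satisfies `‖a‖ ≤ q_v^{n²} + 1`. Proved from the definitions (Hecke operators as finite sums
of translates acting on `L²`, `HeckeAlgebra` / `GLnAdelicStructure`), with no named input: see
the module docstring. (The sharp statements are `|a| < q_v^{1/2}`, Jacquet–Shalika (1981),
Cor. (2.5), named fact `norm_satakeParameter_le_sqrt`, and the Ramanujan conjecture `|a| = 1`.)
[folklore] -/
theorem IsSatakeFamilyOf.norm_le {P : CuspidalAutomorphicRepGL n K μ}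
    {S : Set (HeightOneSpectrum (𝓞 K))} {α : SatakeFamily K} (hα : IsSatakeFamilyOf P S α)
    {v : HeightOneSpectrum (𝓞 K)} (hv : v ∉ S) {a : ℂ} (ha : a ∈ α v) :
    ‖a‖ ≤ (v.residueCard : ℝ) ^ (n ^ 2) + 1 := by
  obtain ⟨𝔫, h𝔫, hv𝔫, ϖ, hsat⟩ := hα v hv
  exact norm_le_of_hasSatakeParameterAt h𝔫 hv𝔫 hsat ha

/-- The trivial bound in the form `‖a‖ ≤ q_v^{n² + 1}` (real exponent; `q_v^{n²} + 1 ≤ q_v^{n²} q_v`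
as `q_v ≥ 2`), the shape consumed by the Landau argument below. [folklore] -/
theorem IsSatakeFamilyOf.norm_le_rpow {P : CuspidalAutomorphicRepGL n K μ}
    {S : Set (HeightOneSpectrum (𝓞 K))} {α : SatakeFamily K} (hα : IsSatakeFamilyOf P S α)
    {v : HeightOneSpectrum (𝓞 K)} (hv : v ∉ S) {a : ℂ} (ha : a ∈ α v) :
    ‖a‖ ≤ (v.residueCard : ℝ) ^ ((n : ℝ) ^ 2 + 1) := by
  have hq2 : (2 : ℝ) ≤ v.residueCard := by exact_mod_cast v.one_lt_residueCard
  have hq1 : (1 : ℝ) ≤ v.residueCard := one_le_two.trans hq2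
  refine (hα.norm_le hv ha).trans ?_
  rw [Real.rpow_add (by linarith), Real.rpow_one, ← Real.rpow_natCast]
  push_cast
  have hX : (1 : ℝ) ≤ (v.residueCard : ℝ) ^ ((n : ℝ) ^ 2) := Real.one_le_rpow hq1 (by positivity)
  nlinarith

end TrivialBoundCuspidal


/-! ### The series (5.3.3) under a polynomial bound on the Satake parameters -/

section SeriesPow

variable {K : Type} [Field K] [NumberField K]

/-- **Absolute convergence of (5.3.3) for `re s > 2B + 1`** under a bound `|μ_{j,v}| ≤ q_v^B`:
`|tr A_v^k|² ≤ n² q_v^{2Bk}`, so the terms are `≤ n² (q_v^k)^{-(σ - 2B)}` (Jacquet–Shalika (1981),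
p. 556: the series (1) "being absolutely convergent" in a right half-plane; the case `B = 1/2` is
`summable_jsCoeff_mul_rpow_neg_of_sqrt` of `JacquetShalikaEulerProducts`, whose proof this one
repeats with `q_v^B` for `q_v^{1/2}`). [folklore] -/
theorem summable_jsCoeff_mul_rpow_neg_of_rpow {S : Set (HeightOneSpectrum (𝓞 K))}
    {α : SatakeFamily K} {n : ℕ} {B : ℝ}
    (hb : ∀ v ∉ S, ∀ a ∈ α v, ‖a‖ ≤ (v.residueCard : ℝ) ^ B)
    (hcard : ∀ v ∉ S, Multiset.card (α v) ≤ n) {σ : ℝ} (hσ : 2 * B + 1 < σ) :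
    Summable fun i => jsCoeff S α i * (jsBase S i : ℝ) ^ (-σ) := by
  set t : ℝ := σ - 2 * B with ht
  have ht1 : 1 < t := by linarith
  have ht0 : 0 < t := by linarith
  -- the majorant `n² (2^{-t})^k q_v^{-t}`
  have hgeom : Summable fun k : ℕ => ‖((2 : ℝ) ^ (-t)) ^ k‖ := by
    simp_rw [norm_pow, Real.norm_of_nonneg (Real.rpow_nonneg zero_le_two _)]
    exact summable_geometric_of_lt_one (Real.rpow_nonneg zero_le_two _)
      (Real.rpow_lt_one_of_one_lt_of_neg one_lt_two (by linarith))
  have hq : Summable fun v : {v : HeightOneSpectrum (𝓞 K) // v ∉ S} =>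
      ‖(v.1.residueCard : ℝ) ^ (-t)‖ := by
    simp_rw [Real.norm_of_nonneg (Real.rpow_nonneg (Nat.cast_nonneg _) _)]
    exact (summable_residueCard_rpow_neg ht1).subtype _
  have hmaj : Summable fun i : ℕ × {v : HeightOneSpectrum (𝓞 K) // v ∉ S} =>
      (n : ℝ) ^ 2 * (((2 : ℝ) ^ (-t)) ^ i.1 * (i.2.1.residueCard : ℝ) ^ (-t)) :=
    (summable_mul_of_summable_norm hgeom hq).mul_left _
  refine Summable.of_nonneg_of_le (fun i => mul_nonneg (jsCoeff_nonneg S α i)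
    (Real.rpow_nonneg (Nat.cast_nonneg _) _)) (fun i => ?_) hmaj
  obtain ⟨k, v⟩ := i
  have hq1 : (1 : ℝ) < v.1.residueCard := by exact_mod_cast v.1.one_lt_residueCard
  have hq0 : (0 : ℝ) < v.1.residueCard := zero_lt_one.trans hq1
  have hq2 : (2 : ℝ) ≤ v.1.residueCard := by exact_mod_cast v.1.one_lt_residueCard
  have hQ : (0 : ℝ) < (v.1.residueCard : ℝ) ^ (k + 1) := pow_pos hq0 _
  -- `|p_{k+1}|² ≤ n² (q^{k+1})^{2B}`
  have hp : ‖((α v.1).map (· ^ (k + 1))).sum‖ ^ 2 ≤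
      (n : ℝ) ^ 2 * ((v.1.residueCard : ℝ) ^ (k + 1)) ^ (2 * B) := by
    have h1 := norm_powerSum_le (hb v.1 v.2) (k + 1)
    have h2 : (Multiset.card (α v.1) : ℝ) * ((v.1.residueCard : ℝ) ^ B) ^ (k + 1) ≤
        n * ((v.1.residueCard : ℝ) ^ B) ^ (k + 1) :=
      mul_le_mul_of_nonneg_right (by exact_mod_cast hcard v.1 v.2) (by positivity)
    have h3 : (((v.1.residueCard : ℝ) ^ B) ^ (k + 1)) ^ 2 =
        ((v.1.residueCard : ℝ) ^ (k + 1)) ^ (2 * B) := by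
      rw [← Real.rpow_mul_natCast hq0.le, ← Real.rpow_natCast, ← Real.rpow_mul hq0.le,
        ← Real.rpow_natCast_mul hq0.le]
      congr 1
      push_cast
      ring
    calc ‖((α v.1).map (· ^ (k + 1))).sum‖ ^ 2
          ≤ (n * ((v.1.residueCard : ℝ) ^ B) ^ (k + 1)) ^ 2 :=
          pow_le_pow_left₀ (norm_nonneg _) (h1.trans h2) 2
      _ = (n : ℝ) ^ 2 * ((v.1.residueCard : ℝ) ^ (k + 1)) ^ (2 * B) := by rw [mul_pow, h3]
  -- `(q^{k+1})^{2B} · (q^{k+1})^{-σ} = (q^{k+1})^{-t} ≤ q^{-t} (2^{-t})^k`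
  have hbase : ((jsBase S (k, v) : ℕ) : ℝ) = (v.1.residueCard : ℝ) ^ (k + 1) := by
    simp [jsBase]
  have hpow : ((v.1.residueCard : ℝ) ^ (k + 1)) ^ (2 * B) * ((v.1.residueCard : ℝ) ^ (k + 1)) ^ (-σ) =
      ((v.1.residueCard : ℝ) ^ (k + 1)) ^ (-t) := by
    rw [← Real.rpow_add hQ]
    congr 1
    rw [ht]
    ring
  have hle : ((v.1.residueCard : ℝ) ^ (k + 1)) ^ (-t) ≤
      ((2 : ℝ) ^ (-t)) ^ k * (v.1.residueCard : ℝ) ^ (-t) := by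
    have h3 : (2 : ℝ) ^ k * v.1.residueCard ≤ (v.1.residueCard : ℝ) ^ (k + 1) := by
      rw [pow_succ]
      exact mul_le_mul_of_nonneg_right (pow_le_pow_left₀ zero_le_two hq2 k) hq0.le
    calc ((v.1.residueCard : ℝ) ^ (k + 1)) ^ (-t) ≤ ((2 : ℝ) ^ k * v.1.residueCard) ^ (-t) :=
          Real.rpow_le_rpow_of_nonpos (by positivity) h3 (by linarith)
      _ = ((2 : ℝ) ^ (-t)) ^ k * (v.1.residueCard : ℝ) ^ (-t) := by
          rw [Real.mul_rpow (by positivity) hq0.le, ← Real.rpow_natCast_mul zero_le_two,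
            mul_comm (k : ℝ) (-t), Real.rpow_mul_natCast zero_le_two]
  calc jsCoeff S α (k, v) * ((jsBase S (k, v) : ℕ) : ℝ) ^ (-σ)
        ≤ (n : ℝ) ^ 2 * ((v.1.residueCard : ℝ) ^ (k + 1)) ^ (2 * B) *
            ((v.1.residueCard : ℝ) ^ (k + 1)) ^ (-σ) := by
          rw [hbase]
          refine mul_le_mul_of_nonneg_right ?_ (Real.rpow_nonneg hQ.le _)
          rw [jsCoeff]
          calc ‖((α v.1).map (· ^ (k + 1))).sum‖ ^ 2 / ((k : ℝ) + 1)
                ≤ ‖((α v.1).map (· ^ (k + 1))).sum‖ ^ 2 :=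
                  div_le_self (by positivity) (by linarith [(k.cast_nonneg : (0 : ℝ) ≤ k)])
            _ ≤ _ := hp
    _ = (n : ℝ) ^ 2 * ((v.1.residueCard : ℝ) ^ (k + 1)) ^ (-t) := by rw [mul_assoc, hpow]
    _ ≤ (n : ℝ) ^ 2 * (((2 : ℝ) ^ (-t)) ^ k * (v.1.residueCard : ℝ) ^ (-t)) :=
          mul_le_mul_of_nonneg_left hle (by positivity)

/-- Hence `abscissaOfAbsConv (normSqTraceSeries S α) ≤ 2B + 1` under the bound `|μ_{j,v}| ≤ q_v^B`.
[folklore] -/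
theorem abscissaOfAbsConv_normSqTraceSeries_le_of_rpow {S : Set (HeightOneSpectrum (𝓞 K))}
    {α : SatakeFamily K} {n : ℕ} {B : ℝ}
    (hb : ∀ v ∉ S, ∀ a ∈ α v, ‖a‖ ≤ (v.residueCard : ℝ) ^ B)
    (hcard : ∀ v ∉ S, Multiset.card (α v) ≤ n) :
    LSeries.abscissaOfAbsConv (normSqTraceSeries S α) ≤ (2 * B + 1 : ℝ) :=
  LSeries.abscissaOfAbsConv_le_of_forall_lt_LSeriesSummable fun _ hy =>
    (summable_jsCoeff_mul_rpow_neg_iff S α _).mp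
      (summable_jsCoeff_mul_rpow_neg_of_rpow hb hcard (by exact_mod_cast hy))

/-- **`L_S(s, π × π̄) = exp f(s)` for `re s > 2B + 1`** under the bound `|μ_{j,v}| ≤ q_v^B`
(Jacquet–Shalika (1981), p. 556, (2)–(4): the Euler product `partialPairL S α ᾱ s` converges and
equals the exponential of the Dirichlet series (5.3.3) over `ℕ`; the case `B = 1/2` is
`partialPairL_conjFamily_eq_exp_LSeries`, whose proof this one repeats). [folklore] -/
theorem partialPairL_conjFamily_eq_exp_LSeries_of_rpow {S : Set (HeightOneSpectrum (𝓞 K))}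
    {α : SatakeFamily K} {n : ℕ} {B : ℝ}
    (hb : ∀ v ∉ S, ∀ a ∈ α v, ‖a‖ ≤ (v.residueCard : ℝ) ^ B)
    (hcard : ∀ v ∉ S, Multiset.card (α v) ≤ n) {s : ℂ} (hs : 2 * B + 1 < s.re) :
    partialPairL S α (conjFamily α) s = Complex.exp (LSeries (normSqTraceSeries S α) s) := by
  -- the family over `ℕ × {v ∉ S}` is summable in `ℂ` and sums to `LSeries a s`
  have hsumC : Summable fun i : ℕ × {v : HeightOneSpectrum (𝓞 K) // v ∉ S} =>
      (jsCoeff S α i : ℂ) * (jsBase S i : ℂ) ^ (-s) :=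
    summable_ofReal_mul_natCast_cpow (jsCoeff_nonneg S α) (jsBase_ne_zero S)
      (summable_jsCoeff_mul_rpow_neg_of_rpow hb hcard hs)
  have hL : HasSum (fun i : ℕ × {v : HeightOneSpectrum (𝓞 K) // v ∉ S} =>
      (jsCoeff S α i : ℂ) * (jsBase S i : ℂ) ^ (-s)) (LSeries (normSqTraceSeries S α) s) := by
    rw [normSqTraceSeries, LSeries_fiberCoeff_eq (jsBase_ne_zero S) hsumC]
    exact hsumC.hasSum
  -- sum first over `k`, for each `v ∉ S`
  set g : {v : HeightOneSpectrum (𝓞 K) // v ∉ S} → ℂ := fun v =>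
    -((satakeTensor (α v.1) ((α v.1).map conj)).map fun c =>
      Complex.log (1 - c * ((v.1.residueCard : ℂ) ^ (-s)))).sum with hg
  have hx : ∀ v : {v : HeightOneSpectrum (𝓞 K) // v ∉ S},
      (v.1.residueCard : ℝ) ^ B * (v.1.residueCard : ℝ) ^ B * ‖(v.1.residueCard : ℂ) ^ (-s)‖ < 1 := by
    intro v
    have hq1 : (1 : ℝ) < v.1.residueCard := by exact_mod_cast v.1.one_lt_residueCard
    have hq0 : (0 : ℝ) < v.1.residueCard := zero_lt_one.trans hq1
    rw [norm_natCast_cpow_of_pos (zero_lt_one.trans v.1.one_lt_residueCard), neg_re,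
      ← Real.rpow_add hq0, ← Real.rpow_add hq0]
    exact Real.rpow_lt_one_of_one_lt_of_neg hq1 (by linarith)
  have hfib : ∀ v : {v : HeightOneSpectrum (𝓞 K) // v ∉ S},
      HasSum (fun k : ℕ => (jsCoeff S α (k, v) : ℂ) * (jsBase S (k, v) : ℂ) ^ (-s)) (g v) := by
    intro v
    have h := hasSum_normSq_powerSum_mul_pow_div (hb v.1 v.2) (hx v)
    refine (h.congr_fun fun k => ?_)
    rw [jsCoeff_mul_cpow_neg]
  have hG : HasSum g (LSeries (normSqTraceSeries S α) s) :=
    HasSum.prod_fiberwise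
      ((Equiv.prodComm {v : HeightOneSpectrum (𝓞 K) // v ∉ S} ℕ).hasSum_iff.mpr hL) hfib
  -- exponentiate
  have hP := hG.cexp
  have hfun : (cexp ∘ g) = fun v : {v : HeightOneSpectrum (𝓞 K) // v ∉ S} =>
      ((satakePairPolynomial (α v.1) (conjFamily α v.1)).eval ((v.1.residueCard : ℂ) ^ (-s)))⁻¹ := by
    funext v
    simp only [Function.comp_apply, hg, conjFamily_apply]
    exact exp_neg_sum_log_eq_inv_eval_satakePairPolynomial_conj (hb v.1 v.2) (hx v)
  rw [hfun] at hP
  exact hP.tprod_eq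

/-- **Landau's lemma applied to (5.3.3)** under the bound `|μ_{j,v}| ≤ q_v^B` (Jacquet–Shalika
(1981), p. 556): if `partialPairL S α ᾱ` (on some right half-plane) extends to a function
holomorphic on `re s > 1`, then (5.3.3) converges for every `σ > 1` — the Dirichlet series over
`ℕ` has non-negative coefficients, abscissa `≤ 2B + 1`, and exponential equal to the continued
function on `re s > max(x₀, 2B + 1)`, so `Literature.NumberTheory.LFunctions.Landau.abscissaOfAbsConv_le_of_exp_eq` gives
abscissa `≤ 1`. [folklore] -/
theorem summable_jsCoeff_mul_rpow_neg_of_continuation_of_rpow {S : Set (HeightOneSpectrum (𝓞 K))}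
    {α : SatakeFamily K} {n : ℕ} {B : ℝ}
    (hb : ∀ v ∉ S, ∀ a ∈ α v, ‖a‖ ≤ (v.residueCard : ℝ) ^ B)
    (hcard : ∀ v ∉ S, Multiset.card (α v) ≤ n) {F : ℂ → ℂ} {x₀ : ℝ}
    (hF : DifferentiableOn ℂ F {s : ℂ | 1 < s.re})
    (hFeq : ∀ s : ℂ, x₀ < s.re → F s = partialPairL S α (conjFamily α) s)
    {σ : ℝ} (hσ : 1 < σ) :
    Summable fun i => jsCoeff S α i * (jsBase S i : ℝ) ^ (-σ) := by
  have h2 := abscissaOfAbsConv_normSqTraceSeries_le_of_rpow hb hcard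
  have hax : LSeries.abscissaOfAbsConv (normSqTraceSeries S α) ≤ (max x₀ (2 * B + 1) : ℝ) :=
    h2.trans (by exact_mod_cast le_max_right _ _)
  have h1 : LSeries.abscissaOfAbsConv (normSqTraceSeries S α) ≤ (1 : ℝ) :=
    Literature.NumberTheory.LFunctions.Landau.abscissaOfAbsConv_le_of_exp_eq (normSqTraceSeries_nonneg S α) hax hF
      fun s hs => by
        rw [hFeq s ((le_max_left _ _).trans_lt hs),
          partialPairL_conjFamily_eq_exp_LSeries_of_rpow hb hcard
            ((le_max_right _ _).trans_lt hs)]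
  have hsum : LSeriesSummable (normSqTraceSeries S α) σ := by
    refine LSeriesSummable_of_abscissaOfAbsConv_lt_re (h1.trans_lt ?_)
    rw [ofReal_re]
    exact_mod_cast hσ
  exact (summable_jsCoeff_mul_rpow_neg_iff S α σ).mpr hsum

/-- The same conclusion in the shape of `summable_normSq_trace_satakePow`:
`∑_{(k, v)} |p_{k+1}(α v)|² / ((k+1) q_v^{(k+1)σ}) < ∞` for `σ > 1`. [folklore] -/
theorem summable_normSq_trace_of_continuation_of_rpow {S : Set (HeightOneSpectrum (𝓞 K))}
    {α : SatakeFamily K} {n : ℕ} {B : ℝ}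
    (hb : ∀ v ∉ S, ∀ a ∈ α v, ‖a‖ ≤ (v.residueCard : ℝ) ^ B)
    (hcard : ∀ v ∉ S, Multiset.card (α v) ≤ n) {F : ℂ → ℂ} {x₀ : ℝ}
    (hF : DifferentiableOn ℂ F {s : ℂ | 1 < s.re})
    (hFeq : ∀ s : ℂ, x₀ < s.re → F s = partialPairL S α (conjFamily α) s)
    {σ : ℝ} (hσ : 1 < σ) :
    Summable fun kv : ℕ × {v : HeightOneSpectrum (𝓞 K) // v ∉ S} =>
      ‖((α kv.2.1).map (· ^ (kv.1 + 1))).sum‖ ^ 2 /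
        ((kv.1 + 1 : ℝ) * (kv.2.1.residueCard : ℝ) ^ ((kv.1 + 1 : ℝ) * σ)) :=
  (summable_jsCoeff_mul_rpow_neg_of_continuation_of_rpow hb hcard hF hFeq hσ).congr fun i =>
    jsCoeff_mul_rpow_neg S α σ i

/-! ### Recovering the bound `|μ_{j,v}| ≤ q_v^{1/2}` from (5.3.3), for one family -/

/-- **(5.3.3) at `σ` bounds the parameters by `q_v^{σ/2}`, for one family** (the pointwise form
of `norm_satakeParameter_le_rpow_of_summable` of `AutomorphicLFunctionProofs`, same proof): the
terms of a convergent series of non-negative reals are bounded by its sum `T`, so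
`|tr A_v^j|² ≤ T j (q_v^{σ/2})^{2j}` for `j ≥ 1`, and `norm_le_of_mem_of_normSq_powerSum_le`
applies. [folklore] -/
theorem norm_le_rpow_half_of_summable_normSq_trace {S : Set (HeightOneSpectrum (𝓞 K))}
    {α : SatakeFamily K} {σ : ℝ}
    (hs : Summable fun kv : ℕ × {v : HeightOneSpectrum (𝓞 K) // v ∉ S} =>
      ‖((α kv.2.1).map (· ^ (kv.1 + 1))).sum‖ ^ 2 /
        ((kv.1 + 1 : ℝ) * (kv.2.1.residueCard : ℝ) ^ ((kv.1 + 1 : ℝ) * σ)))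
    {v : HeightOneSpectrum (𝓞 K)} (hv : v ∉ S) {a : ℂ} (ha : a ∈ α v) :
    ‖a‖ ≤ (v.residueCard : ℝ) ^ (σ / 2) := by
  have hq0 : (0 : ℝ) < v.residueCard := by exact_mod_cast (zero_lt_one.trans v.one_lt_residueCard)
  set F : ℕ × {v : HeightOneSpectrum (𝓞 K) // v ∉ S} → ℝ := fun kv =>
      ‖((α kv.2.1).map (· ^ (kv.1 + 1))).sum‖ ^ 2 /
        ((kv.1 + 1 : ℝ) * (kv.2.1.residueCard : ℝ) ^ ((kv.1 + 1 : ℝ) * σ)) with hF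
  have hF0 : ∀ kv, 0 ≤ F kv := fun kv => by positivity
  refine norm_le_of_mem_of_normSq_powerSum_le (α v) (A := ∑' kv, F kv) (d := 1)
    (Real.rpow_nonneg hq0.le _) (fun j hj => ?_) ha
  obtain ⟨k, rfl⟩ : ∃ k, j = k + 1 := ⟨j - 1, by omega⟩
  have hle : ‖((α v).map (· ^ (k + 1))).sum‖ ^ 2 /
      ((k + 1 : ℝ) * (v.residueCard : ℝ) ^ ((k + 1 : ℝ) * σ)) ≤ ∑' kv, F kv :=
    hs.le_tsum (k, ⟨v, hv⟩) fun kv _ => hF0 kv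
  have hpos : (0 : ℝ) < (k + 1 : ℝ) * (v.residueCard : ℝ) ^ ((k + 1 : ℝ) * σ) := by positivity
  have hexp : ((v.residueCard : ℝ) ^ (σ / 2)) ^ (2 * (k + 1)) =
      (v.residueCard : ℝ) ^ ((k + 1 : ℝ) * σ) := by
    rw [← Real.rpow_natCast, ← Real.rpow_mul hq0.le]
    congr 1
    push_cast
    ring
  calc ‖((α v).map (· ^ (k + 1))).sum‖ ^ 2
        ≤ (∑' kv, F kv) * ((k + 1 : ℝ) * (v.residueCard : ℝ) ^ ((k + 1 : ℝ) * σ)) :=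
          (div_le_iff₀ hpos).mp hle
    _ = _ := by
          rw [pow_one, hexp]
          push_cast
          ring

open Topology Filter in
/-- **(5.3.3) for all `σ > 1` recovers (5.1.3), for one family:** `‖a‖ ≤ q_v^{1/2}` for every
`a ∈ α v`, `v ∉ S` (`σ → 1+` in `norm_le_rpow_half_of_summable_normSq_trace`; the pointwise form of
`norm_satakeParameter_le_sqrt_of_summable`). [folklore] -/
theorem norm_le_sqrt_of_summable_normSq_trace {S : Set (HeightOneSpectrum (𝓞 K))}
    {α : SatakeFamily K}
    (hs : ∀ σ : ℝ, 1 < σ → Summable fun kv : ℕ × {v : HeightOneSpectrum (𝓞 K) // v ∉ S} =>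
      ‖((α kv.2.1).map (· ^ (kv.1 + 1))).sum‖ ^ 2 /
        ((kv.1 + 1 : ℝ) * (kv.2.1.residueCard : ℝ) ^ ((kv.1 + 1 : ℝ) * σ)))
    {v : HeightOneSpectrum (𝓞 K)} (hv : v ∉ S) {a : ℂ} (ha : a ∈ α v) :
    ‖a‖ ≤ Real.sqrt v.residueCard := by
  have hq0 : (0 : ℝ) < v.residueCard := by exact_mod_cast (zero_lt_one.trans v.one_lt_residueCard)
  have hlim : Tendsto (fun σ : ℝ => (v.residueCard : ℝ) ^ (σ / 2)) (𝓝[>] 1)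
      (𝓝 ((v.residueCard : ℝ) ^ ((1 : ℝ) / 2))) :=
    (((Real.continuousAt_const_rpow hq0.ne').comp (continuousAt_id.div_const 2)).tendsto).mono_left
      nhdsWithin_le_nhds
  rw [Real.sqrt_eq_rpow]
  exact ge_of_tendsto hlim (eventually_nhdsWithin_of_forall fun σ hσ =>
    norm_le_rpow_half_of_summable_normSq_trace (hs σ hσ) hv ha)

end SeriesPow

/-! ### `multipliable_L` from Lemma (5.2) alone -/

section Lemma52Only

variable {n : ℕ} {K : Type} [Field K] [NumberField K]
  {μ : Measure (AdelicGroupData.gl n K).automorphicQuotient}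
  [(AdelicGroupData.gl n K).IsAutomorphicMeasure μ]

/-- **(5.3.3)–(5.3.4) from Lemma (5.2) alone, for the finite exceptional sets of the lemma.** For
a cuspidal `Π`, a finite `S ⊇ S₀` and a Satake family `α` of `Π` off `S`, Lemma (5.2)
(`JacquetShalika1981_continuation_partialPairL_conj`) gives the convergence of
`∑_{v ∉ S} ∑_k |tr A_v^k|² / (k q_v^{kσ})` for `σ > 1`, the half-plane of absolute convergence
being supplied by the *trivial* bound `IsSatakeFamilyOf.norm_le_rpow` (`B = n² + 1`) instead of
(5.1.3) (compare `summable_normSq_trace_finset_of_lemma52`, which assumes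
`norm_satakeParameter_le_sqrt`). [cite: JacquetShalikaAJM1981, Thm. (5.3), proof, (5.3.3)–(5.3.4)] -/
theorem summable_normSq_trace_finset_of_lemma52'
    (h₅₂ : JacquetShalika1981_continuation_partialPairL_conj (μ := μ))
    (P : CuspidalAutomorphicRepGL n K μ) :
    ∃ S₀ : Finset (HeightOneSpectrum (𝓞 K)), ∀ ⦃S : Finset (HeightOneSpectrum (𝓞 K))⦄
      ⦃α : SatakeFamily K⦄, S₀ ⊆ S → IsSatakeFamilyOf P ↑S α → ∀ ⦃σ : ℝ⦄, 1 < σ →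
        Summable fun kv : ℕ × {v : HeightOneSpectrum (𝓞 K) // v ∉ (↑S : Set _)} =>
          ‖((α kv.2.1).map (· ^ (kv.1 + 1))).sum‖ ^ 2 /
            ((kv.1 + 1 : ℝ) * (kv.2.1.residueCard : ℝ) ^ ((kv.1 + 1 : ℝ) * σ)) := by
  obtain ⟨S₀, hS₀⟩ := h₅₂ P
  refine ⟨S₀, fun S α hS hα σ hσ => ?_⟩
  obtain ⟨F, x₀, hF, hFeq⟩ := hS₀ hS hα
  exact summable_normSq_trace_of_continuation_of_rpow (n := n) (B := (n : ℝ) ^ 2 + 1)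
    (fun v hv a ha => hα.norm_le_rpow hv ha) (fun v hv => (hα.card_eq hv).le) hF hFeq hσ

/-- **Lemma (5.2) implies (5.1.3) off the exceptional sets of the lemma:** for finite `S ⊇ S₀`
and a Satake family `α` of a cuspidal `Π` off `S`, `‖a‖ ≤ q_v^{1/2}` for all `a ∈ α v`, `v ∉ S`
(the classical remark that the holomorphy of `L_S(s, π × π̄)` on `re s > 1` already bounds the
local parameters by `q_v^{1/2}`; here from `summable_normSq_trace_finset_of_lemma52'` and
`norm_le_sqrt_of_summable_normSq_trace`). [cite: JacquetShalikaAJM1981, (5.1.3), Lemma (5.2)] -/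
theorem norm_le_sqrt_finset_of_lemma52
    (h₅₂ : JacquetShalika1981_continuation_partialPairL_conj (μ := μ))
    (P : CuspidalAutomorphicRepGL n K μ) :
    ∃ S₀ : Finset (HeightOneSpectrum (𝓞 K)), ∀ ⦃S : Finset (HeightOneSpectrum (𝓞 K))⦄
      ⦃α : SatakeFamily K⦄, S₀ ⊆ S → IsSatakeFamilyOf P ↑S α →
        ∀ v ∉ (↑S : Set (HeightOneSpectrum (𝓞 K))), ∀ a ∈ α v,
          ‖a‖ ≤ Real.sqrt v.residueCard := by
  obtain ⟨S₀, hS₀⟩ := summable_normSq_trace_finset_of_lemma52' h₅₂ P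
  exact ⟨S₀, fun S α hS hα v hv a ha =>
    norm_le_sqrt_of_summable_normSq_trace (fun σ hσ => hS₀ hS hα hσ) hv ha⟩

/-- **`multipliable_L` from Lemma (5.2) alone** — Jacquet–Shalika's Thm. (5.3) (case `p = 1`,
`π' = 1` of Remark (5.4)) over the tree's honest definitions with the continuation of
`L_S(s, π × π̄)` to `re s > 1` (Lemma (5.2), `JacquetShalika1981_continuation_partialPairL_conj`)
as the **only** named input: the half-plane of convergence of (4) comes from the proved trivial
bound (`IsSatakeFamilyOf.norm_le_rpow`) instead of Cor. (2.5) / (5.1.3); Landau's lemma gives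
(5.3.3) for `σ > 1` off `S' = D.S ∪ S₀` (`summable_normSq_trace_finset_of_lemma52'`), which recovers
(5.1.3) off `S'` (`norm_le_sqrt_of_summable_normSq_trace`) and then the absolute convergence of the
Satake Euler product off `S'` (`multipliable_inv_eulerFactor`); the finitely many factors at
`v ∈ S'` do not affect multipliability. Supersedes `StandardLFunctionData.multipliable_L_of_lemma52`
(which also assumed `norm_satakeParameter_le_sqrt`).
[cite: JacquetShalikaAJM1981, Thm. (5.3), Lemma (5.2), Remark (5.4)] -/
theorem StandardLFunctionData.multipliable_L_of_lemma52' {P : CuspidalAutomorphicRepGL n K μ}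
    (h₅₂ : JacquetShalika1981_continuation_partialPairL_conj (μ := μ)) :
    StandardLFunctionData.multipliable_L (P := P) := by
  classical
  intro D s hs
  obtain ⟨S₀, hS₀⟩ := summable_normSq_trace_finset_of_lemma52' h₅₂ P
  set S' : Finset (HeightOneSpectrum (𝓞 K)) := D.S ∪ S₀ with hS'
  have hsub : (↑D.S : Set (HeightOneSpectrum (𝓞 K))) ⊆ ↑S' := by
    rw [hS', Finset.coe_union]
    exact Set.subset_union_left
  have hα' : IsSatakeFamilyOf P ↑S' D.α := D.isSatakeFamily.mono hsub
  have hsum : ∀ σ : ℝ, 1 < σ → Summable fun kv : ℕ × {v : HeightOneSpectrum (𝓞 K) // v ∉ (↑S' : Set _)} =>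
      ‖((D.α kv.2.1).map (· ^ (kv.1 + 1))).sum‖ ^ 2 /
        ((kv.1 + 1 : ℝ) * (kv.2.1.residueCard : ℝ) ^ ((kv.1 + 1 : ℝ) * σ)) :=
    fun σ hσ => hS₀ Finset.subset_union_right hα' hσ
  have hmul := multipliable_inv_eulerFactor (n := n)
    (fun v hv a ha => norm_le_sqrt_of_summable_normSq_trace hsum hv ha)
    (fun v hv => (hα'.card_eq hv).le) hs (hsum s.re hs)
  refine Multipliable.mul_compl (s := (↑S' : Set (HeightOneSpectrum (𝓞 K)))) (S'.multipliable _) ?_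
  refine hmul.congr fun v => ?_
  have hv : v.1 ∉ D.S := fun h => v.2 (hsub (Finset.mem_coe.mpr h))
  simp only [Function.comp_apply, D.localFactor_of_not_mem v.1 hv]

end Lemma52Only


section Lemma52Flath

variable {n : ℕ} {K : Type} [Field K] [NumberField K]
  {μ : Measure (AdelicGroupData.gl n K).automorphicQuotient}
  [(AdelicGroupData.gl n K).IsAutomorphicMeasure μ]

/-- **Summability off `S` from summability off `T ⊆ S ∪ F`, `F` finite** (real-valued families
indexed by the complement of a set of places: finitely many extra indices, and an injection into
the old index set for the rest; compare `summable_prod_compl_of_subset_union_finite` of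
`JacquetShalikaEulerProducts`). [folklore] -/
theorem summable_compl_of_subset_union_finite {X : Type*} {g : X → ℝ}
    {S T F : Set X} (hF : F.Finite) (hT : T ⊆ S ∪ F)
    (hsum : Summable fun v : {v : X // v ∉ T} => g v.1) :
    Summable fun v : {v : X // v ∉ S} => g v.1 := by
  rw [← summable_subtype_and_compl (s := {v : {v : X // v ∉ S} | v.1 ∈ F})]
  constructor
  · haveI : Finite {v : {v : X // v ∉ S} // v ∈ {v : {v : X // v ∉ S} | v.1 ∈ F}} := by
      let ι : {v : {v : X // v ∉ S} // v ∈ {v : {v : X // v ∉ S} | v.1 ∈ F}} → F :=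
        fun v => ⟨v.1.1, v.2⟩
      haveI := hF.to_subtype
      refine Finite.of_injective ι ?_
      rintro ⟨⟨v, hv⟩, hvF⟩ ⟨⟨v', hv'⟩, hvF'⟩ h
      simp only [ι, Subtype.mk.injEq] at h
      subst h
      rfl
    exact Summable.of_finite
  · let κ : {v : {v : X // v ∉ S} // v ∈ {v : {v : X // v ∉ S} | v.1 ∈ F}ᶜ} → {v : X // v ∉ T} :=
      fun v => ⟨v.1.1, fun hT' => (hT hT').elim v.1.2 v.2⟩
    have hκ : Function.Injective κ := by
      rintro ⟨⟨v, hv⟩, hvF⟩ ⟨⟨v', hv'⟩, hvF'⟩ h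
      simp only [κ, Subtype.mk.injEq] at h
      subst h
      rfl
    exact hsum.comp_injective hκ

/-- **`absolutelyConvergent_partialStandardL` from Lemma (5.2) and the finiteness of
ramification** (no local bound assumed): for an arbitrary `S` off which `Π` has a Satake family
`α`, enlarge `α` by chosen Satake parameters at the unramified places of `S`
(`exists_isSatakeFamilyOf_of_eventually_cofinite`, Flath), apply Lemma (5.2) with the trivial
bound off the finite set `S' = {ramified places} ∪ S₀` to get (5.3.3) for all `σ > 1`, hence
(5.1.3) and `∑_{v ∉ S'} ‖L(s, Π_v) - 1‖ < ∞` there (`summable_norm_inv_eulerFactor_sub_one`), and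
pass to `v ∉ S` by adding the finitely many places of `S' ∖ S`
(`summable_compl_of_subset_union_finite`). [cite: JacquetShalikaAJM1981, Thm. (5.3), Remark (5.4)] -/
theorem absolutelyConvergent_partialStandardL_of_lemma52'
    (h₅₂ : JacquetShalika1981_continuation_partialPairL_conj (μ := μ))
    (hfl : eventually_cofinite_isUnramifiedAt (μ := μ)) :
    absolutelyConvergent_partialStandardL (μ := μ) := by
  classical
  intro P S α hα s hs
  obtain ⟨R, β, -, hβ⟩ := exists_isSatakeFamilyOf_of_eventually_cofinite hfl P
  obtain ⟨S₀, hS₀⟩ := summable_normSq_trace_finset_of_lemma52' h₅₂ P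
  set S' : Finset (HeightOneSpectrum (𝓞 K)) := R ∪ S₀ with hS'
  -- the enlarged family: `α` off `S`, the chosen parameters `β` on `S`
  let α' : SatakeFamily K := fun v => if v ∈ S then β v else α v
  have hα'S : ∀ v ∉ S, α' v = α v := fun v hv => if_neg hv
  have hα' : IsSatakeFamilyOf P ↑S' α' := by
    intro v hv
    have hvR : v ∉ (↑R : Set _) := fun h => hv (by
      rw [hS', Finset.coe_union]; exact Or.inl h)
    by_cases hvS : v ∈ S
    · simp only [α', if_pos hvS]
      exact hβ v hvR
    · simp only [α', if_neg hvS]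
      exact hα v hvS
  have hsum' : ∀ σ : ℝ, 1 < σ →
      Summable fun kv : ℕ × {v : HeightOneSpectrum (𝓞 K) // v ∉ (↑S' : Set _)} =>
        ‖((α' kv.2.1).map (· ^ (kv.1 + 1))).sum‖ ^ 2 /
          ((kv.1 + 1 : ℝ) * (kv.2.1.residueCard : ℝ) ^ ((kv.1 + 1 : ℝ) * σ)) :=
    fun σ hσ => hS₀ Finset.subset_union_right hα' hσ
  have hA : Summable fun v : {v : HeightOneSpectrum (𝓞 K) // v ∉ (↑S' : Set _)} =>
      ‖((eulerPolynomial (α' v.1)).eval ((v.1.residueCard : ℂ) ^ (-s)))⁻¹ - 1‖ :=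
    summable_norm_inv_eulerFactor_sub_one (n := n)
      (fun v hv a ha => norm_le_sqrt_of_summable_normSq_trace hsum' hv ha)
      (fun v hv => (hα'.card_eq hv).le) hs (hsum' s.re hs)
  -- transfer from `(S', α')` to `(S, α)`
  have hT : (↑S' : Set (HeightOneSpectrum (𝓞 K))) ⊆ S ∪ (↑S' \ S) := by
    rw [Set.union_sdiff_self]
    exact Set.subset_union_right
  have hmain := summable_compl_of_subset_union_finite
    (g := fun v => ‖((eulerPolynomial (α' v)).eval ((v.residueCard : ℂ) ^ (-s)))⁻¹ - 1‖)
    (S'.finite_toSet.subset Set.sdiff_subset) hT hA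
  refine hmain.congr fun v => ?_
  simp only [hα'S v.1 v.2]

/-- Hence `multipliable_partialStandardL` from Lemma (5.2) and the finiteness of ramification
(`multipliable_partialStandardL_of_absolutelyConvergent`). [cite: JacquetShalikaAJM1981, Thm. (5.3), Remark (5.4)] -/
theorem multipliable_partialStandardL_of_lemma52'
    (h₅₂ : JacquetShalika1981_continuation_partialPairL_conj (μ := μ))
    (hfl : eventually_cofinite_isUnramifiedAt (μ := μ)) :
    multipliable_partialStandardL (μ := μ) :=
  multipliable_partialStandardL_of_absolutelyConvergent
    (absolutelyConvergent_partialStandardL_of_lemma52' h₅₂ hfl)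

/-- Hence the splitting `L(s, Π) = (∏_{v ∈ S} P_v(q_v^{-s})⁻¹) · L^S(s, Π)` on `re s > 1`
(`StandardLFunctionData.L_eq_partialStandardL_mul`) from Lemma (5.2) and the finiteness of
ramification (`L_eq_partialStandardL_mul_of_multipliable_partialStandardL`). [folklore] -/
theorem StandardLFunctionData.L_eq_partialStandardL_mul_of_lemma52'
    {P : CuspidalAutomorphicRepGL n K μ}
    (h₅₂ : JacquetShalika1981_continuation_partialPairL_conj (μ := μ))
    (hfl : eventually_cofinite_isUnramifiedAt (μ := μ)) :
    StandardLFunctionData.L_eq_partialStandardL_mul (P := P) :=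
  StandardLFunctionData.L_eq_partialStandardL_mul_of_multipliable_partialStandardL
    (multipliable_partialStandardL_of_lemma52' h₅₂ hfl)

end Lemma52Flath


/-! ### Unconditional absolute convergence in the half-plane `re s > n² + 2` -/

section Unconditional

variable {n : ℕ} {K : Type} [Field K] [NumberField K]
  {μ : Measure (AdelicGroupData.gl n K).automorphicQuotient}
  [(AdelicGroupData.gl n K).IsAutomorphicMeasure μ]

/-- **Absolute convergence of the partial standard Euler product on `re s > n² + 2`,
unconditionally** (the analogue for `L_S(s, π)` of Jacquet–Shalika (1981), (5.1.4): "the infinite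
product converges absolutely to an analytic function in some right half-plane", here with the
explicit half-plane supplied by the trivial bound `IsSatakeFamilyOf.norm_le_rpow` instead of
(5.1.3)): `‖∏_{a ∈ α v} (1 - a q_v^{-s}) - 1‖ ≤ (2^n - 1) q_v^{n² + 1 - re s}`
(`norm_eval_eulerPolynomial_sub_one_le`), summable over `v` for `re s > n² + 2`
(`summable_residueCard_rpow_neg`), and inverting the factors preserves absolute convergence
(`summable_norm_inv_sub_one`). No named input. [folklore] -/
theorem absolutelyConvergent_partialStandardL_of_lt_re {P : CuspidalAutomorphicRepGL n K μ}
    {S : Set (HeightOneSpectrum (𝓞 K))} {α : SatakeFamily K} (hα : IsSatakeFamilyOf P S α)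
    {s : ℂ} (hs : (n : ℝ) ^ 2 + 2 < s.re) :
    Summable fun v : {v : HeightOneSpectrum (𝓞 K) // v ∉ S} =>
      ‖((eulerPolynomial (α v.1)).eval ((v.1.residueCard : ℂ) ^ (-s)))⁻¹ - 1‖ := by
  set B : ℝ := (n : ℝ) ^ 2 + 1 with hB
  have hB0 : 0 ≤ B := by positivity
  have ht1 : 1 < s.re - B := by linarith
  let b : {v : HeightOneSpectrum (𝓞 K) // v ∉ S} → ℝ := fun v =>
    (2 ^ n - 1) * (v.1.residueCard : ℝ) ^ (-(s.re - B))
  have hb : Summable b :=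
    ((summable_residueCard_rpow_neg ht1).subtype _).mul_left (2 ^ n - 1)
  refine summable_norm_inv_sub_one hb fun v => ?_
  have hq1 : (1 : ℝ) < v.1.residueCard := by exact_mod_cast v.1.one_lt_residueCard
  have hq0 : (0 : ℝ) < v.1.residueCard := zero_lt_one.trans hq1
  have hx : ‖(v.1.residueCard : ℂ) ^ (-s)‖ ≤ (v.1.residueCard : ℝ) ^ (-s.re) := by
    rw [norm_natCast_cpow_of_pos (zero_lt_one.trans v.1.one_lt_residueCard), neg_re]
  have hprod : (v.1.residueCard : ℝ) ^ B * (v.1.residueCard : ℝ) ^ (-s.re) =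
      (v.1.residueCard : ℝ) ^ (-(s.re - B)) := by
    rw [← Real.rpow_add hq0]
    congr 1
    ring
  have hBt : (v.1.residueCard : ℝ) ^ B * (v.1.residueCard : ℝ) ^ (-s.re) ≤ 1 := by
    rw [hprod]
    exact Real.rpow_le_one_of_one_le_of_nonpos hq1.le (by linarith)
  obtain ⟨h1, -⟩ := norm_eval_eulerPolynomial_sub_one_le (Real.rpow_nonneg hq0.le B) hx hBt
    (α v.1) (fun a ha => hα.norm_le_rpow v.2 ha)
  refine h1.trans ?_
  rw [hprod]
  refine mul_le_mul_of_nonneg_right ?_ (Real.rpow_nonneg hq0.le _)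
  have h2 : (2 : ℝ) ^ Multiset.card (α v.1) ≤ 2 ^ n := by rw [hα.card_eq v.2]
  linarith

/-- Hence the partial standard Euler product of a Satake family of a cuspidal `Π` is multipliable
on `re s > n² + 2`, unconditionally (Mathlib `multipliable_one_add_of_summable`). [folklore] -/
theorem multipliable_partialStandardL_of_lt_re {P : CuspidalAutomorphicRepGL n K μ}
    {S : Set (HeightOneSpectrum (𝓞 K))} {α : SatakeFamily K} (hα : IsSatakeFamilyOf P S α)
    {s : ℂ} (hs : (n : ℝ) ^ 2 + 2 < s.re) :
    Multipliable fun v : {v : HeightOneSpectrum (𝓞 K) // v ∉ S} =>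
      ((eulerPolynomial (α v.1)).eval ((v.1.residueCard : ℂ) ^ (-s)))⁻¹ := by
  refine (multipliable_one_add_of_summable
    (absolutelyConvergent_partialStandardL_of_lt_re hα hs)).congr fun v => ?_
  simp only [add_sub_cancel]

/-- **The full Euler product `∏_v P_v(q_v^{-s})⁻¹` of every standard L-function datum `D` of a
cuspidal `Π` of `GL_n(𝔸_K)` is multipliable on `re s > n² + 2`, unconditionally** (the statement
of the named fact `StandardLFunctionData.multipliable_L` on this smaller half-plane, with no named
input: the trivial bound replaces Jacquet–Shalika; the finitely many factors at `v ∈ D.S` do not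
affect multipliability). In particular `D.L s` is a genuine convergent product there. [folklore] -/
theorem StandardLFunctionData.multipliable_of_lt_re {P : CuspidalAutomorphicRepGL n K μ}
    (D : StandardLFunctionData P) {s : ℂ} (hs : (n : ℝ) ^ 2 + 2 < s.re) :
    Multipliable fun v : HeightOneSpectrum (𝓞 K) =>
      ((D.localFactor v).eval ((v.residueCard : ℂ) ^ (-s)))⁻¹ := by
  refine Multipliable.mul_compl (s := (↑D.S : Set (HeightOneSpectrum (𝓞 K))))
    (D.S.multipliable _) ?_
  refine (multipliable_partialStandardL_of_lt_re D.isSatakeFamily hs).congr fun v => ?_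
  simp only [Function.comp_apply, D.localFactor_of_not_mem v.1 (by simpa using v.2)]

end Unconditional

end Literature.NumberTheory.Automorphic
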